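import Mathlib
import HarnessLib
import HarnessLib.Audit
import Summits.BirchSwinnertonDyer.Statement
import Summits.BirchSwinnertonDyer.BirchSwinnertonDyer.Theorems.ClassRecordThreeCartanOnePlaceDegreeLawAtThreeNatural
import Summits.BirchSwinnertonDyer.BirchSwinnertonDyer.Theorems.ClassRecordThreeCornerTwistWitnessDefs
import Summits.BirchSwinnertonDyer.BirchSwinnertonDyer.Theorems.ClassRecordThreeCornerAtThreeTwinLowerSupplyDefs
import Summits.BirchSwinnertonDyer.BirchSwinnertonDyer.Theorems.ClassRecordThreeCornerAtThreeR23ItemStatements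
import Literature.NumberTheory.EllipticCurves.ShimuraCurveHeegnerSystemPrimitivesAtThreeGuarded
import Summits.BirchSwinnertonDyer.BirchSwinnertonDyer.Theorems.ClassRecordThreeIMCDivAtThreeB
import Summits.BirchSwinnertonDyer.BirchSwinnertonDyer.Theorems.ClassRecordThreeEulerHalvesAtThreeCoStepLDefs
import Summits.BirchSwinnertonDyer.BirchSwinnertonDyer.Theorems.ClassRecordThreeEulerHalvesAtThreeResidualUpperBoundDefs
import Literature.NumberTheory.EllipticCurves.ShimuraCurveHeegnerSystemPrimitivesAtThree
import Literature.NumberTheory.EllipticCurves.LiuZhangZhang2018.PAdicWaldspurgerEllipticCurve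
import Literature.NumberTheory.EllipticCurves.ShimuraCurveHeegnerSystemPrimitivesSplit
import Literature.NumberTheory.EllipticCurves.BertoliniDarmonPrasanna2013.WaldspurgerCMSquareFormula
import Summits.BirchSwinnertonDyer.BirchSwinnertonDyer.Theorems.ClassRecordThreeHsiehDescentKernelOfWaldspurger
import Summits.BirchSwinnertonDyer.BirchSwinnertonDyer.Theorems.ClassRecordThreeBDPValueAtThreeLZZKernel
import Summits.BirchSwinnertonDyer.BirchSwinnertonDyer.Theorems.ClassRecordThreeShimuraHeegnerPrimitivesSplitNamed
import Summits.BirchSwinnertonDyer.BirchSwinnertonDyer.Theorems.ClassRecordThreeCornerTwistWitnessKernel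
import Summits.BirchSwinnertonDyer.BirchSwinnertonDyer.Theorems.KolyvaginRoadThreeKernelHL
import Summits.BirchSwinnertonDyer.BirchSwinnertonDyer.Theorems.ClassRecordThreeShimuraKolyvaginOrderBoundAtThreeSurjSuffices
import Literature.NumberTheory.PAdicHodge.TateSenCharacterInvariants
import Summits.BirchSwinnertonDyer.BirchSwinnertonDyer.Theorems.ManinLocalTwoThreeMazurManinConstantOddPrimes
import Summits.BirchSwinnertonDyer.BirchSwinnertonDyer.Theorems.EisensteinPrimesSteinWuthrichMultCanonicalExists
import Summits.BirchSwinnertonDyer.BirchSwinnertonDyer.Theorems.ErratumRoadFiveShimuraCurveInputsOfParts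
import HarnessLib.Audit.Status.Attr

/-!
Route: KolyvaginRoadThree

# Route KolyvaginRoadThree — BSD(E,3) on class X11b at p = 3 by the Kolyvagin road on A1
(Kolyvagin's conjecture mod 3 + McCallum) and the restricted class record elsewhere

Rung K2 of LADDER-BSD at the prime 3 (cell bsd-stepL atom O2@3 = board atom B10), THIRD route on the
rung leaf
`X11b.MultiplicativeRankOneAtThree` (BSD(E,3) for every E/ℚ with r_an = 1, 3 ∥ N, E[3] irreducible)
— an ALTERNATIVE DECOMPOSITION
of route ClassRecordThree (D-0019 §6; director-bsd ruling (R-ah) 2026-08-25T22:24:09Z). It suffices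
to show
X = ZhangSharpFrameAtThree ∧ SchneiderTamAtThree ∧ HalvesTamAtThree ∧ HsiehDescentAtThree ∧
EulerHalvesAtThree ∧ ShimuraDisplaysAtThree ∧ CornerAtThree:
on the atom A1 = (ram) ∧ 3 ∤ ∏c (1 116 classes, cw 248 943 — the Kolyvagin-road locus of record,
TARGET v1.29 (R-ad)) Kolyvagin's
conjecture mod 3 at EVERY Manin-good conductor-1 frame (the ∀-frame ♯ typing = hypothesis `hZ` of
the landed kernel
`Koly.bsdp_three_onA1_of_kolyvaginFrames`, p410690; tree twin `Koly.ZhangAtThreeSharpFrame`, koly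
p411122) replaces BOTH suppliers of ClassRecordThree (Schneider's
non-degeneracy on non-split 3; the BDP value formula + main-conjecture divisibility on split 3)
through McCallum 1991's exact formula and
one odd Heegner datum; off A1 the class-record inputs stay, restricted to `3 ∣ ∏c` where
ClassRecordThree states them on all of (ram),
and the four residual inputs (descent, Euler half, Shimura displays, corner) are ClassRecordThree's
items 19108–19111 verbatim.
Lean:
`Summit.BirchSwinnertonDyer.BirchSwinnertonDyer.Theses.KolyvaginRoadThree.ZhangSharpFrameAtThree ∧
Summit.BirchSwinnertonDyer.BirchSwinnertonDyer.Theses.KolyvaginRoadThree.SchneiderTamAtThree ∧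
Summit.BirchSwinnertonDyer.BirchSwinnertonDyer.Theses.KolyvaginRoadThree.HalvesTamAtThree ∧
Summit.BirchSwinnertonDyer.BirchSwinnertonDyer.Theses.KolyvaginRoadThree.HsiehDescentAtThree ∧
Summit.BirchSwinnertonDyer.BirchSwinnertonDyer.Theses.KolyvaginRoadThree.EulerHalvesAtThree ∧
Summit.BirchSwinnertonDyer.BirchSwinnertonDyer.Theses.KolyvaginRoadThree.ShimuraDisplaysAtThree ∧
Summit.BirchSwinnertonDyer.BirchSwinnertonDyer.Theses.KolyvaginRoadThree.CornerAtThree`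

## Assembly
Re-plumbing of the koly class record with ONE new case, CERTIFIED against landed theorems. `closes
h₁ … h₈ : X11b.MultiplicativeRankOneAtThree`
binds the seven cruxes and the support conjunction, PROVES the Assembly item inline (`have hA :
Assembly := …`, in the cone, provable-now) and
applies the hub `X11b.multiplicativeRankOneAtThree_of_kolyRecord` (koly p410949; =
`Three.forall_bsdp_of_kolyRecord`, p410349 ✓): h₈ is
destructured into ClassRecordThree's twenty facts ∧ McCallum ∧ Shimura-at-conductor-1 ∧ the
conductor-1 data (seam G-a); the A1 case is
`hA1 := fun W hX hram htam ↦ Koly.bsdp_three_onA1_of_kolyvaginFrames ‹facts› hrec hMc hKD h₁ W hX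
hram htam` (p410690 ✓); the other binders are
projections of h₂ … h₇ in the record's order (hReg = h₂, hDb ∕ hDd = h₄'s clauses, hHb ∕ hHd = h₃'s
clauses, hSh = h₆, hUα ∕ hUγ ∕ hU₀ = h₅'s
clauses, hCL ∕ hCT ∕ hCU = h₇'s). Without h₁ the leaf is NOT derivable from h₂ … h₈ (A1 is
uncovered: h₂, h₃ carry `3 ∣ ∏c`), which is why the
restricted variants are items and ClassRecordThree's 19106 ∕ 19107 are not binders here. The glue
logic elaborated sorry-free in the planner's
sketch (`onA1_of_items`, `closes_scratch`, lean check rc 0, 2026-08-25T23:2xZ).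

CLOSES_TARGET: closes rung K2 of BirchSwinnertonDyer: Summit.BirchSwinnertonDyer.Rank1Residual.X11b.MultiplicativeRankOneAtThree (D-0061; not the summit Statement) — the deciding theorem of this route concludes that registered leaf instead of the Statement decl `BirchSwinnertonDyer` (class rung: servable and labelled, never counted as concluding the summit Statement).

Rationale: WHY THIS LINE. At p = 3 every printed p-part theorem in analytic rank one excludes the prime
(Skinner–Zhang arXiv:1407.1099 «Throughout, p ≥ 5»; W. Zhang
2014 Thm 1.1 p ≥ 5; JetchevSkinnerWan2017; Castella2018), and ClassRecordThree splits the class by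
the MECHANISM of the 3-adic
L-FUNCTION side (cyclotomic Kato + Schneider; anticyclotomic BDP + main conjecture). This line
brings the OTHER classical mechanism to
bear on the largest atom: the Heegner-point Euler system itself — Kolyvagin's conjecture that some
derived class c_M(n) is non-zero
mod 3 (M = 1 under 3 ∤ ∏c), proved in the cell's memo chain MEMO-v4 → v6 by W. Zhang's induction on
Kolyvagin primes with
level-raising and Jochnowitz congruences re-run at 3 (referee PASS g17 ∕ g19), consumed by
McCallumLMS1991's exact structure theorem for
Ш(E∕K)[3^∞] (a Literature fact valid at every odd p with surjective image) and the tree's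
single-datum consumer
`bsdp_of_indexLowerBoundAt_of_heegnerData_of_odd` (Gross–Zagier + Kolyvagin + Mazur's Manin bound).
No p-adic L-function, no p-adic
height and no main conjecture enters on A1. Imported area: Euler systems ∕ level-raising
(Bertolini–Darmon, W. Zhang) at a small prime;
nothing outside number theory. The line's kernel is LANDED: koly p409453 (STEP L on A1 from Z₃♯),
p410016 (one non-zero class + McCallum ⟹ BSD(E,3), end to end),
p410690 (`Koly.bsdp_three_onA1_of_kolyvaginFrames`: the whole A1 road modulo exactly the crux and
the published inputs), p410349 (the
koly class record `Three.forall_bsdp_of_kolyRecord`) and the hub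
`X11b.multiplicativeRankOneAtThree_of_kolyRecord` (p410949) that `closes` applies.

RANKED CRUXES. #2 ZhangSharpFrameAtThree (crux) — DECIDING — Kolyvagin's conjecture mod 3 at 3 ∥ N
in the ∀-FRAME ♯ typing: for every E/ℚ globally minimal with multiplicative reduction at 3, ρ̄_(E,3)
onto, a (ram) witness (a multiplicative ℓ ≠ 3 with 3 ∤ ord_ℓ Δ_min), 3 ∤ ∏ c_ℓ, every imaginary
quadratic Heegner field K for N with d_K ≠ −3, and EVERY conductor-1 frame (Dt, β, ι) with 4N ∣ β² −
d_K whose Manin constant is prime to 3, some Kolyvagin class c_1(n) with Kolyvagin-prime support n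
is non-zero in H¹(K, E[3]) — verbatim the hypothesis `hZ` of the landed kernel
`Koly.bsdp_three_onA1_of_kolyvaginFrames` (p410690; a frame through [3] kills every mod-3 class,
hence the Manin-good binder); covers ALL of A1 (1 116 classes, cw 248 943); at the field of record 3
∣ I_K on every A1 row (x11b3 E-K6), so the content is a DERIVED class, n > 1. [difficulty:
open-problem] (why it might fail: p = 3 is excluded by every printed non-vanishing theorem (W. Zhang
2014 Thm 1.1, Skinner–Zhang 2014, Sweeting: p ≥ 5); level-raising at 3 and mod-3 multiplicity one
are memo steps (MEMO-v4 §§2–4), refereed, not in print; one A1 pair and Manin-good frame with every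
c_1(n) = 0 refutes it.) [WZhang2014, arXiv:1407.1099, arXiv:2012.11771, McCallumLMS1991,
arXiv:0707.0032]
#3 SchneiderTamAtThree (crux) — road (a) OFF A1: for E ∈ X11b at 3 with a (ram) witness, NON-SPLIT
multiplicative reduction at 3 and 3 ∣ ∏ c_ℓ, the cyclotomic 3-adic regulator does not vanish
(`ClassClosure.RegulatorNonvanishingAt W 3`) — ClassRecordThree's SchneiderAtThree (item 19106)
restricted to the Tamagawa cells; implied by it (one-line proof `schneiderTamAtThree_of` in the
sketch). [difficulty: open-problem] (why it might fail: Schneider's conjecture has no class-wide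
mechanism even in rank one; a rank-1 curve with 3 ∥ N non-split, 3 ∣ ∏c and vanishing cyclotomic
3-adic height of its generator refutes it (none among the 5 546 checked, REG-MULT).)
[Literature.Barriers.BirchSwinnertonDyer.PAdicHeightNondegeneracy, Kato2004Asterisque,
SteinWuthrich2013]
#4 HalvesTamAtThree (crux) — roads (b)/(d) OFF A1: for E ∈ X11b at 3, on (3 split ∧ (ram) ∧ 3 ∣ ∏c)
and on (¬(ram) ∧ ρ̄ onto), both STEP-L halves at 3 hold — the BDP value formula `Three.BDPValueAt₃
W` (H2, THEOREM C ∕ C♯ of the cell: memo-proved and refereed) and the main-conjecture divisibility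
`Three.IMCDivAt₃ W` (H3, open) — ClassRecordThree's HalvesAtThree (item 19107) with the Tamagawa
binder added in the (ram) clause; implied by it (`halvesTamAtThree_of`). [difficulty: open-problem]
(why it might fail: H3 at p = 3: the Eisenstein-congruence machinery (Skinner–Urban ∕ Wan) needs p ≥
5 for μ = 0 and big-image lemmas on GU(3,1); at 3 the anticyclotomic μ-invariant of L_3^BDP may be
positive (Kim–Ohta type phenomena); the split-3 clause sits in the exceptional-zero regime.)
[Castella2018, Castella2018Erratum, Hsieh2014, arXiv:2107.13726]
#5 HsiehDescentAtThree (crux) — the named S24-b descent residual `Three.HsiehDescentAt₃ W` on the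
same two loci: from the two halves at 3 to the 3-part of the BSD formula over K and down to ℚ
(control of the anticyclotomic Selmer group at 3 ∥ N, the local condition at 3, and the twist
descent), a step printed nowhere at p = 3. [deps: HalvesTamAtThree] [difficulty: L] (why it might
fail: anticyclotomic control at p = 3 with 3 ∥ N meets a possibly non-trivial error term from
E(ℚ₃)[3] and the component group (c₃ may be divisible by 3 on the split locus), which the p ≥ 5
proofs (JSW §3) kill by hypothesis.) [JetchevSkinnerWan2017, Hsieh2014, GreenbergLNM1716]
#6 EulerHalvesAtThree (crux) — (T2′)₃: the Euler-system (upper-bound) half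
`Typed.MissingUpperBoundAt W 3` for E ∈ X11b at 3 on the Tamagawa sub-atom (α) with a (ram) witness,
on (γ∖α) split with a (ram) witness, and on the ¬(ram) ∧ surj locus — where Kolyvagin's bound at 3
loses units to 3 ∣ ∏ c_ℓ or to a non-Manin-good parametrisation. [difficulty: XL] (why it might
fail: Kolyvagin-system rigidity at p = 3 (Mazur–Rubin) needs hypotheses on E[3] that surjectivity
alone does not give when 3 ∣ c_ℓ (the transverse condition at ℓ fails); no printed upper bound at 3
absorbs Tamagawa factors.) [McCallumLMS1991, Kato2004Asterisque, JetchevSkinnerWan2017]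
#7 ShimuraDisplaysAtThree (crux) — (T2♯-ℝ)₃: the Shimura-curve displays `P2ShimuraDisplaysAt W 3` on
the pure-β Shimura sub-atom at 3 (3 split ∧ (ram) ∧ ¬(α) ∧ ¬(γ) ∧ 3 ∣ ∏ c_ℓ): Pasten §6 identities,
degree links, real Gross–Zagier on X_{N⁺,N⁻} and (U-Sh) at p = 3. [difficulty: L] (why it might
fail: (U-Sh) #Ш(E/K)[3^∞] ≤ 3^{2 ord_3 [E(K):ℤP]} on a Shimura curve at p = 3 is outside every
printed range (JSW Thm 4.4.1 needs p ≥ 5); Ribet–Takahashi's degree comparison has an uncontrolled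
factor at primes of non-split multiplicative reduction.) [PastenShimura2024, CaiShuTian2014,
JetchevSkinnerWan2017]
#8 CornerAtThree (crux) — (T4″)₃: the non-surjective corner at 3 (E ∈ X11b at 3 with ρ̄_{E,3} not
onto): its STEP L `Three.CornerStepLAt W`, its twist supply `Three.CornerTwistAt W` and its upper
half `Three.CornerUpperAt W` (0 TRUE-OPEN classes N < 5·10⁵ by per-pair certificates; class-wide
open). [difficulty: L] (why it might fail: with ρ̄_{E,3} irreducible but not onto (image in a
normaliser of a Cartan) the mod-3 Kolyvagin classes may all vanish, and the twist supply with
prescribed 3-adic behaviour is a Friedberg–Hoffstein statement with a local condition at 3 not in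
print.) [BalakrishnanEtAl2019, MatarNekovar2019, FriedbergHoffstein1995]
#9 PublishedInputsKolyThree (support) — the PUBLISHED named facts of the line as one conjunction:
ClassRecordThree's twenty facts verbatim (Gross–Zagier, Kolyvagin ×2, Skinner 2016 Thm C, Wuthrich
2014, rank = r_an ≤ 1, modularity, newforms, Hoffstein–Luo, Mazur's Manin constant, Poitou–Tate,
Friedberg–Hoffstein inert, Barrios et al. 2025, Skinner Thm A, Stein–Wuthrich Thm 6.1 + canonical
subgroup, Disegni 2020, modular parametrisations, Matar–Nekovář, Hsieh 2014) ∧ McCallum 1991's exact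
structure theorem for Ш[p^∞] from a Kolyvagin certificate ∧ the conductor-1 Heegner-point
Galois-conjugation record (Shimura reciprocity; Gross 1984 §§3–4) ∧ seam G-a: a conductor-1
Kolyvagin–Heegner datum EXISTS on every admissible frame (CM theory: «x₁ is rational over K₁», Gross
1984 §3, Gross 1991 §3; verbatim the hypothesis `hKD` of p410690; to be replaced BY NAME once koly ∕
lit land the Literature fact `exists_kolyvaginHeegnerData_one`); the Néron scaling fact is a tree
THEOREM and is not listed. [difficulty: provable-now] [McCallumLMS1991, Gross1984HeegnerPoints,
GrossLMS1991, Kato2004Asterisque, Skinner2016PacificMC, SteinWuthrich2013, Disegni2020,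
MatarNekovar2019, Hsieh2014]

TWO-LAYER PLAN. ZhangSharpFrameAtThree ⇐ (MEMO-v4 §§2–4 as STUBS of its BC3 skeleton: level-raising
at 3 with Ihara's lemma at an admissible prime, mod-3
multiplicity one on the definite quaternion algebra, W. Zhang's induction on Kolyvagin primes rooted
at a 3-good level-raised node) + the
PLAN-ONLY BC5 rung `stub_rung_347253a1` (the crux at ONE A1 pair at its field of record: 347253a1 ⊗
ℚ(√−11), ℓ = 17) — stubs, not items; the
seams of the g20 design are gone (G-b dissolved by the frame typing; G-a is a published conjunct of
the support). The (T2′)@3 ∕ ¬(ram) ∕ corner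
quartet is shared with ClassRecordThree and decomposes there, not here.

KILL CRITERIA. ONE A1 pair (E, K) and ONE Manin-good conductor-1 frame at which every Kolyvagin
class c_1(n) (n of Kolyvagin-prime support) vanishes refutes
ZhangSharpFrameAtThree and closes the route `refuted:ZhangSharpFrameAtThree` (ClassRecordThree is
unaffected); computable evidence against
it: on a depth-1 row (Ш_an(E) = 1, 9 ∥ Ш_an(E^{d_K}), M₀ = 1) Kolyvagin–McCallum (Cor 5.5 ∕ 5.6)
force M₁ = 0 under the crux, so a run of level-1
certificates P_ℓ ∈ 3·E(K_ℓ) at the first k Kolyvagin primes ℓ is evidence at odds ≈ 2^(−k); a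
positive anticyclotomic μ-invariant of L_3^BDP on a
(T2′)@3 split curve refutes HalvesTamAtThree (shared fate with ClassRecordThree's 19107); BSD(E,3)
for the class proved through ClassRecordThree
supersedes this route.

NOT DECOMPOSED YET. The memo steps behind ZhangSharpFrameAtThree (level-raising at 3, multiplicity
one mod 3, the Kolyvagin-prime induction) are ONE crux at open
(they share every hypothesis and the referee graded them as one chain; they appear as stubs of the
BC3 skeleton); the g20 design's glue item
`KolyGlueAtThree` is not an item any more — it is the landed theorem p410690; the residual quartet
is ClassRecordThree's and is not re-cut.

CHEAPEST FALSIFIER. CORRECTED (x11b3 g65; ruling (R-am)): at the field of record K₀ all 1 081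
two-engine A1 rows of x11b3's E-K6 table have 3 ∣ [E(K₀) : ℤ y_K]
(ord₃ = 1 on 1 049, 2 on 32, 0 on none), so c(1) ≡ 0 mod 3 and an n = 1 certificate is the 1990
index certificate, not a ♯ witness. The cheapest
♯-specific check is ONE level-1 derived-point certificate «P_ℓ ∉ 3·E(K_ℓ)» (⇔ c_1(ℓ) ≢ 0) at the
smallest Kolyvagin prime of a small A1 pair:
6474c1 = [1,1,0,−4414,−125636] (N = 2·3·13·83, non-split at 3, ∏c = 1) ⊗ ℚ(√−263), ℓ = 5 (a₅ = −3,
inert, [K₅ : ℚ] = 156), by supersingular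
reduction at ℓ (Jetchev–Kane ∕ Stein: Brandt module of B_{5,∞}, Eichler level 6474, dim ≈ 4.7·10³,
exact linear algebra mod 3); the h_K = 1
instance for the complex-analytic Jetchev–Lauter–Stein method (arXiv:0707.0032 §§3–5) is the BC5
rung pair 347253a1 ⊗ ℚ(√−11), ℓ = 17
([K₁₇ : ℚ] = 36). Candidate table: planner `kolyprimes.py` (STATUS (R-am)); pricing of record: x11b3
`PREDICTIONS-KOLY2.md` (one trial row, no
production run). Expected P₅ ∉ 3E(K₅); the opposite at the first few Kolyvagin primes is the
evidence of §Kill criteria.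

NUMBERS. O2@3 (B10): 5 546 X11b classes at 3 with N < 5·10⁵, 1 684 TRUE-OPEN; A1 = (ram) ∧ 3 ∤ ∏c ∧
surj = 1 116 TRUE-OPEN classes (cw 248 943),
all on the Z₃♯ locus (TARGET v1.29 §2a, (R-ad)); (T2′)@3 = (ram) ∧ 3 ∣ ∏c = 568 TRUE-OPEN (X1 444 ∪
X2 305 ∪ X3 226); ¬(ram) and the
corner as in ClassRecordThree; at the field of record ord₃[E(K₀) : ℤ y_K] ≥ 1 on 1 081 ∕ 1 081
two-engine A1 rows (x11b3 E-K6: 1 049 × 1, 32 × 2),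
so every ♯ certificate on A1 is a derived class (n > 1); no census number moves by this route (T7).

DEFINITION REQUESTS. None: every notion is a tree declaration (`ModularParametrizationData`,
`KolyvaginHeegnerData`, `KolyvaginHeegnerData.kolyvaginClass`,
`KolyvaginDescent.KolSupp`, `Zhang2014.IsKolyvaginPrime`, `IsImaginaryQuadratic`,
`SatisfiesHeegnerHypothesis`, `Rank1Residual.Ram` ∕ `Surj`,
`ClassX11b`, `ClassClosure.RegulatorNonvanishingAt`, `Three.BDPValueAt₃`, `Three.IMCDivAt₃`,
`Three.HsiehDescentAt₃`, `Three.ShapeAlpha`,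
`Three.ShapeGamma`, `P2ShimuraDisplaysAt`, `Typed.MissingUpperBoundAt`, `Three.CornerStepLAt`,
`Three.CornerTwistAt`, `Three.CornerUpperAt`,
`McCallum1991_pow_dvd_card_sha_primary_of_certificate`, `heegnerPointOfConductor_one_galoisConj`,
`BSDp`), all in the import closure of the two
Theorems hubs named in the front matter. WANTED (not blocking): the Literature named fact
`exists_kolyvaginHeegnerData_one` (koly ∕ lit; (R-aj),
(R-an)) to replace the support's 4th conjunct by name.

Novelty: Searches (2026-08-25): lit search --hybrid "Kolyvagin conjecture non-vanishing Kolyvagin classes mod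
p level raising p = 3" (8 docs: [corpus:book:cornell1997-modular-forms-fermats-last-theorem pp
658–660], [corpus:paper:arxiv-2405.00270 pp 3, 11–12] Burungale–Castella–Skinner base change and
IMC, [corpus:paper:nekovar2011-level-raising-anticyclotomic-selmer-groups-hilbert-modular pp 6–7],
[corpus:book:editornd-l-functions-arithmetic p 232] (McCallum),
[corpus:book:coates1999-arithmetic-theory-elliptic-curves p 248]); lit vsearch (papers) "Kolyvagin's
conjecture … non-zero modulo p … p = 3" (8 docs, none relevant); lit galaxy search "Kolyvagin's
conjecture|Kolyvagin conjecture|Jochnowitz congruence" --star all (1 row: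
[galaxy:panama:350795748868160] «p-adic aspects of modular forms»); the cell's reading list (W.
Zhang 2014 [corpus:paper:doi-10-4310-cjm-2014-v2-n2-a2 p 3 «p ≥ 5»], Skinner–Zhang arXiv:1407.1099 p
5 «Throughout, p ≥ 5», Sweeting arXiv:2012.11771 (acq-11097), McCallumLMS1991
[corpus:book:editornd-l-functions-arithmetic pp 284–292]).
Nearest prior art found: W. Zhang, Camb. J. Math. 2 (2014) Thm 1.1 (Kolyvagin's conjecture for p ≥ 5
under Hypothesis ♠) and Skinner–Zhang arXiv:1407.1099 Thm 1.3 (p ∥ N, p ≥ 5); nearest listed route: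
ClassRecordThree (same leaf; 3-adic L-function mechanisms on A1) — delta: the A1 supplier is the
Euler-system non-vanishing mod 3, not Schneider ∕ BDP + IMC. v2 (planner g21, 2026-08-25T23:2xZ):
statements re-typed against the landed kern  [refs: 1407.1099, 2012.11771, 0707.0032, book:cornell1997-modular-forms-fermats-last-theorem, paper:arxiv-2405.00270, paper:nekovar2011-level-raising-anticyclotomic-selmer-groups-hilbert-modular, book:editornd-l-functions-arithmetic, book:coates1999-arithmetic-theory-elliptic-curves, paper:doi-10-4310-cjm-2014-v2-n2-a2, McCallumLMS1991]

Barriers (technique_class: heegner-points, kolyvagin-system, level-raising): - technique_class: heegner-points, kolyvagin-system, level-raising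
- Literature.Barriers.BirchSwinnertonDyer.HeegnerPointBarrier: inside the class by design (r_an = 1:
one non-torsion Heegner point and its Kolyvagin derivatives are the whole supply needed); the
barrier limits rank ≥ 2 only — it does not quantify over ZhangSharpFrameAtThree.
- Literature.Barriers.BirchSwinnertonDyer.HeegnerPointBarrierNarrow: same placement; derived
Kolyvagin classes mod p are explicitly outside the Narrow barrier's scope.
- Literature.Barriers.BirchSwinnertonDyer.PAdicHeightBarrier: OUTSIDE for ZhangSharpFrameAtThree (no
p-adic height, no regulator anywhere on A1); SchneiderTamAtThree IS the barrier's open statement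
restricted to rank one, 3 ∥ N non-split, (ram), 3 ∣ ∏c — it does not evade it; the bet is per-pair
decidability (numerically non-zero on all 527 core classes, BIRTH-CERT of ClassRecordThree) exactly
as for item 19106, on a smaller locus.
- Literature.Barriers.BirchSwinnertonDyer.ExceptionalZeroBarrier: OUTSIDE for the A1 items (no
p-adic L-function; split ∕ non-split at 3 is irrelevant to the Kolyvagin system and to McCallum's
formula); HalvesTamAtThree's split clause is inside the regime exactly as ClassRecordThree's 19107
and avoids the cyclotomic function (anticyclotomic BDP at the trivial character; Disegni's corrected
formula as support fact).
- Literature.Barriers.BirchSwinnertonDyer.ExceptionalZeroBarrierNarrow: same — no identity of the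
route uses L_p(E,T) at split multipl

History (route lifecycle, newest last):
- 2026-08-26T03:06:45Z · rev 2: restated OpenValueReciprocityAtThree (stmt-BirchSwinnertonDyer-19239) — sharpen the split child in place (shared item; same restate as route-BirchSwinnertonDyer-ClassRecordThree rev 4 d0a04b96ccae → stmt-BirchSwinnertonDyer-19281): (planner-bsd-stepL-plan-g23-0)
- 2026-08-26T06:21:16Z · rev 7: dropped CornerTwistLeafAtThree — D2 prep (items cap): detach the banked-context aside CornerTwistLeafAtThree (19409) from KOLY only — it stays on K2@3 route-BirchSwinnertonDyer-ClassRecordThree (planner-bsd-stepL-plan-g24-0)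
- 2026-08-28T19:20:38Z · rev 36: dropped EulerHalvesAtThreeCoStepLResidual — RULING 75 fallback: temporary drop of crux EulerHalvesAtThreeCoStepLResidual (23175) to restore staffability — its body reaches two @[conjecture]-TAGGED paramet (planner-bsd-stepL-plan-g42-0)

sub-problem: BirchSwinnertonDyer · status: open · opened planner-bsd-stepL-plan-g22-0 2026-08-26T00:33:59Z · rev 47 · ledger route-BirchSwinnertonDyer-KolyvaginRoadThree
GENERATED by the gate from the ledger (D-0016/17). Provers cite these decls: `theorem foo : Summit.BirchSwinnertonDyer.BirchSwinnertonDyer.Theses.KolyvaginRoadThree.<Decl> := …` in Summits/BirchSwinnertonDyer/BirchSwinnertonDyer/Theorems/<Name>.lean.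
-/

namespace Summit.BirchSwinnertonDyer.BirchSwinnertonDyer.Theses.KolyvaginRoadThree

open scoped BigOperators Topology Manifold Classical MeasureTheory ProbabilityTheory Matrix InnerProductSpace ComplexConjugate ContinuousMap
open Filter Set Function TopologicalSpace MeasureTheory

attribute [summit_statement] _root_.BirchSwinnertonDyer
attribute [summit_statement] _root_.Summit.BirchSwinnertonDyer.Rank1Residual.X11b.MultiplicativeRankOneAtThree

open Literature

/-- item stmt-BirchSwinnertonDyer-19154 · crux · rank 3 · open · by planner
why it might fail: Schneider's conjecture has no class-wide mechanism even in rank one; a rank-1 curve with 3 ∥ N non-split, 3 ∣ ∏c and vanishing cyclotomic 3-adic height of its generator refutes it (none among the 5 546 checked, REG-MULT).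
sources: Literature.Barriers.BirchSwinnertonDyer.PAdicHeightNondegeneracy, Kato2004Asterisque, SteinWuthrich2013
[crux] road (a) OFF A1: for E ∈ X11b at 3 with a (ram) witness, NON-SPLIT multiplicative reduction
at 3 and 3 ∣ ∏ c_ℓ, the cyclotomic 3-adic regulator does not vanish
(`ClassClosure.RegulatorNonvanishingAt W 3`) — ClassRecordThree's SchneiderAtThree (item 19106)
restricted to the Tamagawa cells; implied by it (one-line proof `schneiderTamAtThree_of` in the
sketch). [difficulty: open-problem] -/
@[route_item "route-BirchSwinnertonDyer-KolyvaginRoadThree", crux]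
def SchneiderTamAtThree : Prop :=
  ∀ (W : WeierstrassCurve ℚ) [W.IsElliptic] [W.IsGloballyMinimal], Summit.BirchSwinnertonDyer.Rank1Residual.ClassX11b W 3 → Literature.NumberTheory.EllipticCurves.Rank1Residual.Ram W 3 → ¬ W.HasSplitMultiplicativeReductionAtPrime 3 → 3 ∣ W.tamagawaProduct → Summit.BirchSwinnertonDyer.Rank1Residual.X11b.ClassClosure.RegulatorNonvanishingAt W 3

/-- item stmt-BirchSwinnertonDyer-32276 · crux · rank 4 · open · by planner
why it might fail: Not in print (Kohen–Pacetti Rem. 3.8): outside 24801's X11b fibre a Cartan-frame Manin/congruence defect at 9 ∣ M (additive 3) or an Ihara-type index-3 saturation (SAT₃) at a principal-series place q ≡ 1 (3), c_q = 3 could break the exact +1; the sweep has only 8 such PS pairs — next falsifier.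
sources: KohenPacetti2016, Rem. 3.8 and §2 (arXiv:1403.7801v3 pp. 7-8, 15), CaiShuTian2014, §1.2 p. 5, Prop. 3.8 p. 21, Ribet1990, Thm 1 (Ihara / level raising), VignerasLNM800, Ch. III §5, Zywina2015, Prop. 1.14/1.16, p768893 Theorems/ClassRecordThreeCartanOnePlaceDegreeLawAtThreeNatural.lean (tree, 2026-08-30)
[crux] NUM♮ BY NAME — the CLASS-BLIND one-place degree law at a non-split Cartan place (director-bsd
(528) YES / (532)(b) 2026-08-30: statement = the route-independent constant
`CartanCorrespondence.CartanOnePlaceDegreeLawAtThreeNatural` of p768893 ✓ (LEAD tam3-p1 g36,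
`Theorems/ClassRecordThreeCartanOnePlaceDegreeLawAtThreeNatural.lean`, commit 126406117d34; body =
794 chars sig-sha16 dd477430ced6347c = this pen's `hnat` = stepL pen's text, byte-identical); ONE
ledger item by identical normalised signature across RamifiedHeegnerPair (crux r302 under U₁, here)
and ClassRecordThree / KolyvaginRoadThree (stepL pen files the same constant; first filer creates,
second attaches)): item 24801's body with the class binder `ClassX11b V 3 →` deleted and `Surj V 3`
kept (Surj ⇒ ¬CM ∧ E[3] irreducible are tree theorems): for V/ℚ with ρ̄_{V,3} onto, conductor N =
D·M·∏_{p∈C} p², a Cartan place q ∈ C (q ≠ 3, q³ ∤ N, 3 ∣ c_q(V)), class-minimal Cartan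
parametrisation data Q at (D, M; C) and Q′ at (D, Mq²; C∖q): ord₃ deg Q′ = ord₃ deg Q + 1. BY-NAME
CONSEQUENCES (LANDED one-liners of p768893: `cartanOnePlaceDegreeLawAtThree_of_natural` NUM♮ → NUM
24801, `leafCartanOnePlaceDegreeLawAtThree_of_natur -/
@[route_item "route-BirchSwinnertonDyer-KolyvaginRoadThree", crux]
def CartanOnePlaceDegreeLawAtThreeNatural : Prop :=
  Summit.BirchSwinnertonDyer.BirchSwinnertonDyer.Theorems.CartanCorrespondence.CartanOnePlaceDegreeLawAtThreeNatural

/-- item stmt-BirchSwinnertonDyer-19109 · crux · rank 6 · open · by planner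
why it might fail: Kolyvagin-system rigidity at p = 3 (Mazur–Rubin) needs hypotheses on E[3] that surjectivity alone does not give when 3 ∣ c_ℓ (the transverse condition at ℓ fails); no printed upper bound at 3 absorbs Tamagawa factors.
sources: McCallumLMS1991, Kato2004Asterisque, JetchevSkinnerWan2017
[crux] (T2′)₃: the Euler-system (upper-bound) half `Typed.MissingUpperBoundAt W 3` for E ∈ X11b at 3
on the Tamagawa sub-atom (α) with a (ram) witness, on (γ∖α) split with a (ram) witness, and on the
¬(ram) ∧ surj locus — where Kolyvagin's bound at 3 loses units to 3 ∣ ∏ c_ℓ or to a non-Manin-good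
parametrisation. [difficulty: XL] -/
@[route_item "route-BirchSwinnertonDyer-KolyvaginRoadThree", crux]
def EulerHalvesAtThree : Prop :=
  ∀ (W : WeierstrassCurve ℚ) [W.IsElliptic] [W.IsGloballyMinimal], Summit.BirchSwinnertonDyer.Rank1Residual.ClassX11b W 3 → (Literature.NumberTheory.EllipticCurves.Rank1Residual.Ram W 3 → Summit.BirchSwinnertonDyer.Rank1Residual.X11b.Three.ShapeAlpha W → Literature.NumberTheory.EllipticCurves.Rank1Residual.Typed.MissingUpperBoundAt W 3) ∧ (Literature.NumberTheory.EllipticCurves.Rank1Residual.Ram W 3 → W.HasSplitMultiplicativeReductionAtPrime 3 → ¬ Summit.BirchSwinnertonDyer.Rank1Residual.X11b.Three.ShapeAlpha W → Summit.BirchSwinnertonDyer.Rank1Residual.X11b.Three.ShapeGamma W → Literature.NumberTheory.EllipticCurves.Rank1Residual.Typed.MissingUpperBoundAt W 3) ∧ (Literature.NumberTheory.EllipticCurves.Rank1Residual.Surj W 3 → ¬ Literature.NumberTheory.EllipticCurves.Rank1Residual.Ram W 3 → Literature.NumberTheory.EllipticCurves.Rank1Residual.Typed.MissingUpperBoundAt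 W 3)

/-- item stmt-BirchSwinnertonDyer-21420 · crux · rank 8 · SPLIT (gen 1) into KatoTwinFactsThreeOutside, ShimuraPrimitivesAtThreeGuardedFact, ShimuraPrimitivesWithSplitNormTDAtThree, CornerFHTwinLowerSupplyAtThree, CornerTwinLowerModEightAtThree, CornerTwistMuAnAtThree + glue CornerAtThreeWGlue · direct attempts still welcome (low priority) · by planner
why it might fail: (L) and (U) have NO printed display on the ¬Surj corner (Castella/Jetchev/Howard all assume Surj or p ∤ ∏c); (W) needs BSD₃ of ONE rank-0 non-surjective split-at-3 twist — Skinner–Urban/Kato displays void there; a single corner pair with ord₃Ш(E^d) above the Kato bound for every Heegner d kills it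
sources: Castella2018, Jetchev2008, GrossLMS1991, Miller2011LMS, HoffsteinLuo1997, Skinner2016PacificMC
[crux] (T4″)₃ corner at 3, TWIST-WITNESS SHAPE (plan g37 RULING 33 + ADDENDUM; supersedes 19111
`CornerAtThree` as the load-bearing corner crux, 19111 kept aside as the stronger ∀-(Tw) variant):
for every global minimal W with (E,3) ∈ X11b and ρ̄_{E,3} NOT surjective (forced: split
multiplicative at 3, no (ram) prime, 3 ∣ ∏ c_ℓ; 296 LMFDB pairs ≤ 500k) — (L) STEP L
`Three.CornerStepLAt W` (Castella 2018 Thm 3.2 shape read without Surj: a Heegner class of exact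
3-divisibility index = analytic Sha order at an admissible odd K) ∧ (W)
`Theorems.CornerTwistWitness.CornerTwistWitnessAt W` (p556532; the ∃-RECUT of (Tw): SOME odd Heegner
field K, d_K < −4, Heegner for N and for 3, L(E^{d_K},1) ≠ 0, and BSD₃ of a global minimal model of
that ONE rank-0 twist — exactly what the three corner consumers use of (Tw); strictly weaker than
(Tw) by `cornerTwistWitnessAt_of_cornerTwistAt` + Hoffstein–Luo) ∧ (U) `Three.CornerUpperAt W` (the
Euler-system upper bound #Ш[3^∞] ∣ 3^{2·ord₃ I_K} off every printed hypothesis). Consumed by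
`closes` through the Theses-free kernel twins
`Theorems.multiplicativeRankOneAtThree_of_classRecord_upperB_of_twistWitness` ∕
`…_of_kolyRecord_upperB_of_twistWitness` (mul -/
@[route_item "route-BirchSwinnertonDyer-KolyvaginRoadThree", crux]
def CornerAtThreeW : Prop :=
  ∀ (W : WeierstrassCurve ℚ) [W.IsElliptic] [W.IsGloballyMinimal], Summit.BirchSwinnertonDyer.Rank1Residual.X11b.Three.CornerStepLAt W ∧ Summit.BirchSwinnertonDyer.BirchSwinnertonDyer.Theorems.CornerTwistWitness.CornerTwistWitnessAt W ∧ Summit.BirchSwinnertonDyer.Rank1Residual.X11b.Three.CornerUpperAt W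

-- parent: CornerAtThreeW · child (gen 1)
/--     item stmt-BirchSwinnertonDyer-23541 · crux · rank 804 · open
    parent: CornerAtThreeW · by planner
    why it might fail: class-wide it needs non-vanishing of L(E^d,1) mod 3 with PRESCRIBED local behaviour at T; Ono–Skinner 1998 Cor 3 excludes p | 6N and Friedberg–Hoffstein gives non-vanishing but not the 3-adic unit; a curve with all admissible twins 3-divisible would refute it.
    sources: OnoSkinner1998, FriedbergHoffstein1995, Kolyvagin1990
[crux child of CornerAtThreeW, #4 of corner3-p2 g16 ITEMS-R23] for every corner curve (X11b at 3,
rho surjective, 3 inert in the Heegner field) and every even multiplicative set T, SOME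
Friedberg–Hoffstein twin frame (T inert, other bad primes split, |d_K| > 4, L(E^{d_K},1) ≠ 0)
carrying the twin's printed ≥-half; binder hTL3 of cornerAtThreeW_of_itemsR22K; beyond print
class-wide, per pair a finite modular-symbol certificate (lane B g6 census j292957: 824/824). -/
@[route_item "route-BirchSwinnertonDyer-KolyvaginRoadThree"]
def CornerFHTwinLowerSupplyAtThree : Prop :=
  Summit.BirchSwinnertonDyer.BirchSwinnertonDyer.Theorems.CornerAtThreeFHTwinLowerSupply

-- parent: CornerAtThreeW · child (gen 1)
/--     item stmt-BirchSwinnertonDyer-23542 · crux · rank 805 · open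
    parent: CornerAtThreeW · by planner
    why it might fail: needs, per odd-conductor corner curve, a Heegner discriminant d ≡ 1 (mod 8) whose twin has analytic Sha[3] matching the printed lower half; census 61/61 (least |d| ≤ 1271) is evidence per pair, not a class-wide theorem; a 3-divisibility obstruction along d ≡ 1 (8) would kill it.
    sources: GrossZagier1986, Kolyvagin1990, BumpFriedbergHoffstein1990
[crux child of CornerAtThreeW, #5] = r22 stub_cornerTwinLowerModEight3 VERBATIM (Theses-free copy
R23Items.CornerTwinLowerModEight, Iff.rfl with CornerTwinHalves.CornerTwinLowerModEight; corner3-p2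
p668842): ONE d_K ≡ 1 (mod 8) odd Heegner twin frame per corner curve with the ≥-half in print
shape; binder hT8; bites on odd N only (61/296 pairs). -/
@[route_item "route-BirchSwinnertonDyer-KolyvaginRoadThree"]
def CornerTwinLowerModEightAtThree : Prop :=
  Summit.BirchSwinnertonDyer.BirchSwinnertonDyer.Theorems.R23Items.CornerTwinLowerModEight

-- parent: CornerAtThreeW · child (gen 1)
/--     item stmt-BirchSwinnertonDyer-23543 · crux · rank 806 · open
    parent: CornerAtThreeW · by planner
    why it might fail: analytic μ = 0 at p = 3 is open class-wide (Greenberg 1999 Conj 1.11); known for ρ̄ surjective only via Kato+Skinner–Urban at good ordinary p under extra hypotheses, not for every quadratic twist at a multiplicative/inert 3; one twin with μ > 0 refutes it.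
    sources: Greenberg1999, Kato2004, EmertonPollackWeston2006
[crux child of CornerAtThreeW, #6] = stub_cornerTwistMuAn3 VERBATIM: analytic μ = 0 at 3 at every
odd Heegner twin of a corner curve (some coefficient of ϖ·L₃ a unit); binder hμ; with the Kato facts
it is the twin's Kato half (p662111); class-wide = Greenberg Conj 1.11 for these twists. -/
@[route_item "route-BirchSwinnertonDyer-KolyvaginRoadThree"]
def CornerTwistMuAnAtThree : Prop :=
  Summit.BirchSwinnertonDyer.BirchSwinnertonDyer.Theorems.CornerAtThreeTwistMuAn

-- parent: CornerAtThreeW · child (gen 1)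
/--     item stmt-BirchSwinnertonDyer-23538 · support · rank 801 · open
    parent: CornerAtThreeW · by planner
[support child, cite_only, #1] the eight printed Kato-side facts used at the twins (Stein–Wuthrich
2013 Thm 6.1 split mult., Greenberg–Stevens, Kato 2004 Thm 12.4 + divisibility inputs
(non-split/split), Greenberg 1999 Thm 1.5 cotorsion, Wuthrich 2014 Cor 18 integrality); binder
hKato8. -/
@[route_item "route-BirchSwinnertonDyer-KolyvaginRoadThree"]
def KatoTwinFactsThreeOutside : Prop :=
  Literature.NumberTheory.EllipticCurves.SteinWuthrich2013.thm61_splitMultiplicative ∧ (∀ (W : WeierstrassCurve ℚ) [W.IsElliptic] [W.IsGloballyMinimal] (p : ℕ) [Fact p.Prime], Literature.NumberTheory.EllipticCurves.greenberg_stevens W p) ∧ Literature.NumberTheory.EllipticCurves.Kato2004.thm12_4 ∧ Literature.NumberTheory.EllipticCurves.Kato2004.exists_multDivisibilityInputs_nonsplit ∧ Literature.NumberTheory.EllipticCurves.Kato2004.exists_multDivisibilityInputs_split ∧ Literature.NumberTheory.EllipticCurves.Greenberg1999.thm15_isTorsion_multiplicative_rat ∧ Literature.NumberTheory.EllipticCurves.Wuthrich2014.corollary18_padicLFunction_mem_iwasawaAlgebra_multiplicative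 ∧ Literature.NumberTheory.EllipticCurves.Kato2004.exists_multDivisibilityInputs_fine

-- parent: CornerAtThreeW · child (gen 1)
/--     item stmt-BirchSwinnertonDyer-23539 · support · rank 802 · open
    parent: CornerAtThreeW · by planner
[support child, cite_only, #2] the guarded (3 split in K) twin of item 23177: Shimura-curve
Heegner-system primitives at 3 (Cai–Shu–Tian / Nekovář / Gross / BD96; typed p572412); binder
hPrimG. -/
@[route_item "route-BirchSwinnertonDyer-KolyvaginRoadThree"]
def ShimuraPrimitivesAtThreeGuardedFact : Prop :=
  Literature.NumberTheory.EllipticCurves.shimuraCurve_heegnerSystem_primitivesAtThreeGuarded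

-- parent: CornerAtThreeW · child (gen 1)
/--     item stmt-BirchSwinnertonDyer-23540 · support · rank 803 · open
    parent: CornerAtThreeW · by planner
[support child, print-level by statement, #3] = stub_upper3_residualMulti r20–r22 VERBATIM
(Theses-free copy R23Items.PrimitivesWithSplitNormTDAtThree, Iff.rfl with
ShimuraWalk.PrimitivesWithSplitNormTDAtThree; corner3-p2 p668842): Shimura-walk primitives with
split norm (Darmon 2004 Prop 3.10 / Def 3.12 / Thm 4.18 for the CM family of X_{N+,N-}); binder
hres. -/
@[route_item "route-BirchSwinnertonDyer-KolyvaginRoadThree"]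
def ShimuraPrimitivesWithSplitNormTDAtThree : Prop :=
  Summit.BirchSwinnertonDyer.BirchSwinnertonDyer.Theorems.R23Items.PrimitivesWithSplitNormTDAtThree

-- parent: CornerAtThreeW · glue (gen 1)
/--     item stmt-BirchSwinnertonDyer-23544 · support · rank 807 · open
    parent: CornerAtThreeW · GLUE: children ⟹ parent · by planner
[support, glue] RULING 80 (planner bsd-stepL g43; corner3-p2 g16 ITEMS-R23-turnkey
54497a3125d53656): the six children (three beyond-print cruxes CornerFHTwinLowerSupplyAtThree /
CornerTwinLowerModEightAtThree / CornerTwistMuAnAtThree + three print supports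
KatoTwinFactsThreeOutside / ShimuraPrimitivesAtThreeGuardedFact /
ShimuraPrimitivesWithSplitNormTDAtThree) imply CornerAtThreeW MODULO the route items
{PublishedInputsThree, ShimuraParametrizationDataNonempty, EulerHalfGrossPrintFacts,
CornerStepLLeafAtThree, PastenComponentOrdersInput, ShimuraPrimitivesAtThreeInertFact,
ShimuraCurveGrossZagierKolyvagin, ShimuraCasselsTateLevelInputs (closed)} by
CornerAtThreeWOfInputs.cornerAtThreeW_of_itemsR22K (p665549 + p667259); ledger-open modulo items
(RULING 67 (a) pattern); kernel certificate = the zero-stub r23 of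
Cruxes/CornerAtThreeW/Lines/inert.lean (corner3-p2 g16, dcd2fdc46f391e6b). Re-informal 22:4xZ only
to refresh the readiness scan after the RULING-80 (c) attribute patches p671037/p671067. -/
@[route_item "route-BirchSwinnertonDyer-KolyvaginRoadThree"]
def CornerAtThreeWGlue : Prop :=
  KatoTwinFactsThreeOutside → ShimuraPrimitivesAtThreeGuardedFact → ShimuraPrimitivesWithSplitNormTDAtThree → CornerFHTwinLowerSupplyAtThree → CornerTwinLowerModEightAtThree → CornerTwistMuAnAtThree → CornerAtThreeW

/-- item stmt-BirchSwinnertonDyer-20263 · crux · rank 402 · open · by planner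
why it might fail: no printed BDP-side divisibility at p = 3 (Wan 2020 Thm 1.1, Castella 2018 Thm 4.4, Skinner–Urban 2014 need p ≥ 5); at 3 ∥ N the U_p-level modifications and Eischen–Wan tame datum are unavailable; a μ-invariant or missing Ihara lemma at 3 could cost a power of 3 (X-slot now at 𝔭bar).
sources: Castella2018, Wan2020, SkinnerUrban2014, FouquetWan2021, Skinner2016PacificMC, Castella2018Erratum
[crux] (H3 on the two HALVES loci (with the extra binder 3 ∣ ∏c_ℓ on the ram locus)) the BDP-side
anticyclotomic MAIN-CONJECTURE DIVISIBILITY at p = 3, RE-ORIENTED: `Three.IMCDivAt₃B W` — for every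
frame (ι′, 𝔭) and the OTHER prime 𝔭bar ∣ 3, Ch_Λ(X_ac(E∕K_∞))_{𝔭bar} · Λ^ur ⊆ (L_𝔭); repairs 19506.
In-cone as registered stub `stub_imcDivTwoLociTamAtThreeR` of the parent `HalvesTamAtThreeR`'s BC3
skeleton (Cruxes/HalvesTamAtThreeR/Lines/birth.lean; `HalvesTamAtThreeR_of` = bdp g16's twin),
alongside the shared VC₃ child 19493 (`stub_valueContinuityAtThree`) — the route cannot re-split
onto an existing decl name, so the parent's decomposition lives in its registered skeleton (BC6
skeleton-aware cone). -/
@[route_item "route-BirchSwinnertonDyer-KolyvaginRoadThree", crux]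
def IMCDivTwoLociTamAtThreeR : Prop :=
  ∀ (W : WeierstrassCurve ℚ) [W.IsElliptic] [W.IsGloballyMinimal], Summit.BirchSwinnertonDyer.Rank1Residual.ClassX11b W 3 → (Literature.NumberTheory.EllipticCurves.Rank1Residual.Ram W 3 → W.HasSplitMultiplicativeReductionAtPrime 3 → 3 ∣ W.tamagawaProduct → Summit.BirchSwinnertonDyer.Rank1Residual.X11b.Three.IMCDivAt₃B W) ∧ (¬ Literature.NumberTheory.EllipticCurves.Rank1Residual.Ram W 3 → Literature.NumberTheory.EllipticCurves.Rank1Residual.Surj W 3 → Summit.BirchSwinnertonDyer.Rank1Residual.X11b.Three.IMCDivAt₃B W)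

/-- item stmt-BirchSwinnertonDyer-19519 · aside · rank 1 · SPLIT (gen 1) into ShimuraParametrizationDataNonempty, PastenRibetTakahashiPackage, ShimuraCurveGrossZagierKolyvagin + glue ShimuraCurveInputsOfParts · direct attempts still welcome (low priority) · by planner
why it might fail: published results; the only risk is a mis-typed fact statement (each is a cite-tagged Literature def reviewed at landing)
sources: PastenShimura2024, RibetTakahashi1997, JacquetLanglands1970, YuanZhangZhang2013, Nekovar2007
[support · published inputs] the Shimura-curve inputs that DISCHARGE the consumed upper half of the
Shimura step (D1 cash-in, shim-p1 memo HOME/shim/SHIM-P1-CASHIN-MEMO.md §2): Jacquet–Langlands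
parametrisation data (nonempty_shimuraParametrizationData), Pasten's Ribet–Takahashi package at a
non-Eisenstein prime (PastenShimura2024_ribetTakahashiPackage), Gross–Zagier–Kolyvagin on Shimura
curves (shimuraCurve_heegnerPoint_grossZagier_kolyvagin). Named Literature facts, used as
hypotheses; with them `classRecordThree_shimuraUpperHalfAtThree_of_published` (p422736/p430775 side)
resp. `missingUpperBoundAt_of_classX11b_of_ram_of_not_alpha_pub` (p420149) give the upper half the
kernels consume, so the crux ShimuraDisplays(AtThree) leaves the cone. -/
@[route_item "route-BirchSwinnertonDyer-KolyvaginRoadThree"]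
def ShimuraCurveInputs : Prop :=
  Literature.NumberTheory.Automorphic.nonempty_shimuraParametrizationData ∧ Literature.NumberTheory.Automorphic.PastenShimura2024_ribetTakahashiPackage ∧ Literature.NumberTheory.EllipticCurves.shimuraCurve_heegnerPoint_grossZagier_kolyvagin

-- parent: ShimuraCurveInputs · child (gen 1)
/--     item stmt-BirchSwinnertonDyer-19524 · support · rank 101 · open
    parent: ShimuraCurveInputs · by planner
    why it might fail: published; only a mis-typed fact statement could fail (reviewed at landing)
    sources: JacquetLanglands1970, BCDTJAMS2001
[support · published input, by-name alias] Jacquet–Langlands / Shimura-curve parametrisation data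
exist for every elliptic curve over ℚ at every admissible (N⁺, N⁻) (named Literature fact
`nonempty_shimuraParametrizationData`; cite: JacquetLanglands1970, BCDTJAMS2001). Declared as an
item so the leaf counts as declared for staffable; HELD (never a prover target). -/
@[route_item "route-BirchSwinnertonDyer-KolyvaginRoadThree", crux]
def ShimuraParametrizationDataNonempty : Prop :=
  Literature.NumberTheory.Automorphic.nonempty_shimuraParametrizationData

-- parent: ShimuraCurveInputs · child (gen 1)
/--     item stmt-BirchSwinnertonDyer-19525 · support · rank 102 · open
    parent: ShimuraCurveInputs · by planner
    why it might fail: published; only a mis-typed fact statement could fail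
    sources: PastenShimura2024, RibetTakahashi1997
[support · published input, by-name alias] Pasten 2024 §6: the Ribet–Takahashi package (degrees of
Shimura-curve parametrisations vs modular degree at a non-Eisenstein prime) — named Literature fact
`PastenShimura2024_ribetTakahashiPackage` (cite: PastenShimura2024, RibetTakahashi1997). Declared
for staffable; HELD. -/
@[route_item "route-BirchSwinnertonDyer-KolyvaginRoadThree", crux]
def PastenRibetTakahashiPackage : Prop :=
  Literature.NumberTheory.Automorphic.PastenShimura2024_ribetTakahashiPackage

-- parent: ShimuraCurveInputs · child (gen 1)
/--     item stmt-BirchSwinnertonDyer-19526 · support · rank 103 · open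
    parent: ShimuraCurveInputs · by planner
    why it might fail: published; only a mis-typed fact statement could fail
    sources: YuanZhangZhang2013, Nekovar2007, Howard2004Duke
[support · published input, by-name alias] Gross–Zagier–Kolyvagin on Shimura curves
(Yuan–Zhang–Zhang, Nekovář, Howard): a Heegner point of non-torsion height on a Shimura-curve
parametrisation gives rank 1 and finite Ш with the index bound — named Literature fact
`shimuraCurve_heegnerPoint_grossZagier_kolyvagin` (cite: YuanZhangZhang2013, Nekovar2007,
Howard2004Duke). Declared for staffable; HELD. -/
@[route_item "route-BirchSwinnertonDyer-KolyvaginRoadThree", crux]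
def ShimuraCurveGrossZagierKolyvagin : Prop :=
  Literature.NumberTheory.EllipticCurves.shimuraCurve_heegnerPoint_grossZagier_kolyvagin

-- parent: ShimuraCurveInputs · glue (gen 1)
/--     item stmt-BirchSwinnertonDyer-19596 · support · rank 104 · closed · proved by erratumRoadFive_shimuraCurveInputsOfParts_holds (prover)
    parent: ShimuraCurveInputs · GLUE: children ⟹ parent · by operator
glue for the split of ShimuraCurveInputs: the children imply the parent -/
@[route_item "route-BirchSwinnertonDyer-KolyvaginRoadThree"]
def ShimuraCurveInputsOfParts : Prop :=
  ShimuraParametrizationDataNonempty → PastenRibetTakahashiPackage → ShimuraCurveGrossZagierKolyvagin → ShimuraCurveInputs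

/-- `ShimuraCurveInputsOfParts` holds: proved by `erratumRoadFive_shimuraCurveInputsOfParts_holds`. -/
theorem ShimuraCurveInputsOfParts_holds : ShimuraCurveInputsOfParts := _root_.erratumRoadFive_shimuraCurveInputsOfParts_holds

/-- item stmt-BirchSwinnertonDyer-19153 · aside · rank 2 · SPLIT (gen 1) into ZhangSharpFrameAtThreeHL, ZhangFrameOffHLAtThree + glue ZhangSharpFrameAtThreeOfHLChildren · direct attempts still welcome (low priority) · by planner
why it might fail: p = 3 is excluded by every printed non-vanishing theorem (W. Zhang 2014 Thm 1.1, Skinner–Zhang 2014, Sweeting: p ≥ 5); level-raising at 3 and mod-3 multiplicity one are memo steps (MEMO-v4 §§2–4), refereed, not in print; one A1 pair and Manin-good frame with every c_1(n) = 0 refutes it.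
sources: WZhang2014, arXiv:1407.1099, arXiv:2012.11771, McCallumLMS1991, arXiv:0707.0032
[crux] DECIDING — Kolyvagin's conjecture mod 3 at 3 ∥ N in the ∀-FRAME ♯ typing: for every E/ℚ
globally minimal with multiplicative reduction at 3, ρ̄_(E,3) onto, a (ram) witness (a
multiplicative ℓ ≠ 3 with 3 ∤ ord_ℓ Δ_min), 3 ∤ ∏ c_ℓ, every imaginary quadratic Heegner field K for
N with d_K ≠ −3, and EVERY conductor-1 frame (Dt, β, ι) with 4N ∣ β² − d_K whose Manin constant is
prime to 3, some Kolyvagin class c_1(n) with Kolyvagin-prime support n is non-zero in H¹(K, E[3]) —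
verbatim the hypothesis `hZ` of the landed kernel `Koly.bsdp_three_onA1_of_kolyvaginFrames`
(p410690; a frame through [3] kills every mod-3 class, hence the Manin-good binder); covers ALL of
A1 (1 116 classes, cw 248 943); at the field of record 3 ∣ I_K on every A1 row (x11b3 E-K6), so the
content is a DERIVED class, n > 1. [difficulty: open-problem] -/
@[route_item "route-BirchSwinnertonDyer-KolyvaginRoadThree", crux]
def ZhangSharpFrameAtThree : Prop :=
  ∀ (W : WeierstrassCurve ℚ) [W.IsElliptic] [W.IsGloballyMinimal] [NeZero (W.conductorNorm ℤ)] (K : Type) [Field K] [NumberField K] (Dt : Literature.NumberTheory.EllipticCurves.ModularForms.ModularParametrizationData W (W.conductorNorm ℤ)) (β : ℤ) (ι : K →+* ℂ), W.HasMultiplicativeReductionAtPrime 3 → Literature.NumberTheory.EllipticCurves.Rank1Residual.Surj W 3 → Literature.NumberTheory.EllipticCurves.Rank1Residual.Ram W 3 → ¬ 3 ∣ W.tamagawaProduct → Literature.NumberTheory.EllipticCurves.IsImaginaryQuadratic K → Literature.NumberTheory.EllipticCurves.SatisfiesHeegnerHypothesis (W.conductorNorm ℤ) K → NumberField.discr K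 ≠ -3 → (4 * (W.conductorNorm ℤ : ℤ)) ∣ β ^ 2 - NumberField.discr K → ¬ (3 : ℤ) ∣ Dt.c → ∃ (n : ℕ) (d : Literature.NumberTheory.EllipticCurves.KolyvaginHeegnerData Dt β ι n), Literature.NumberTheory.EllipticCurves.KolyvaginDescent.KolSupp (Literature.NumberTheory.EllipticCurves.Zhang2014.IsKolyvaginPrime (W.conductorNorm ℤ) W K 3) n ∧ d.kolyvaginClass Nat.prime_three 1 ≠ 0

-- parent: ZhangSharpFrameAtThree · child (gen 1)
/--     item stmt-BirchSwinnertonDyer-19574 · crux · rank 201 · open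
    parent: ZhangSharpFrameAtThree · by planner
    why it might fail: p = 3 is excluded by all printed Kolyvagin non-vanishing theorems (W. Zhang 2014 Thm 1.1, Skinner–Zhang, Sweeting: p ≥ 5); level-raising at 3 and mod-3 multiplicity one are memo steps (MEMO-v4 §§2–4), not in print; one Hoffstein–Luo A1 pair with all c_1(n) = 0 on every Manin-good frame refutes it
    sources: WZhang2014, HoffsteinLuo1997, arXiv:1407.1099, arXiv:2012.11771, McCallumLMS1991, GrossZagier1986Heegner
[crux] DECIDING (HL-sharp restatement of 19153 ZhangSharpFrameAtThree; judge (a) «optional sharper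
frame», director-bsd D2 GO 05:32:30Z) — Kolyvagin's conjecture mod 3 at 3 ∥ N in the ∀-FRAME ♯
typing, asked ONLY on the X11b@3 class and ONLY for Hoffstein–Luo pairs (E, K): for every globally
minimal E/ℚ with ClassX11b E 3, multiplicative reduction at 3, ρ̄_{E,3} onto, a (ram) witness, 3 ∤
∏c_ℓ, every imaginary quadratic Heegner field K for N with d_K ODD, d_K ≠ −3 and L(E^{d_K}, 1) ≠ 0
(so r_an(E/K) = 1 exactly — the rank-≥ 2 worry of the old frame is removed), and every conductor-1
frame (Dt, β, ι) with 4N ∣ β² − d_K and Manin constant prime to 3, some Kolyvagin class c_1(n) with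
Kolyvagin-prime support is non-zero in H¹(K, E[3]) — verbatim the hypothesis `hZ` of the landed HL
kernel
`Summit.BirchSwinnertonDyer.Rank1Residual.X11b.Three.Koly.bsdp_three_onA1_of_kolyvaginFramesHL`
(zhang3-p1 p424749, Theorems/KolyvaginRoadThreeKernelHL.lean). WEAKER than 19153 (certified:
Staged.zhangSharpFrameAtThreeHL_of_X11b ∘ zhangSharpFrameAtThreeX11b_of_old, HOME
zhang3/ClosesRestated19153.lean); 19153 stays in the file as the history def (dropped from closes).
BC5 (T3): plan-only rung `stub_ru -/
@[route_item "route-BirchSwinnertonDyer-KolyvaginRoadThree", crux]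
def ZhangSharpFrameAtThreeHL : Prop :=
  ∀ (W : WeierstrassCurve ℚ) [W.IsElliptic] [W.IsGloballyMinimal] [NeZero (W.conductorNorm ℤ)] (K : Type) [Field K] [NumberField K] (Dt : Literature.NumberTheory.EllipticCurves.ModularForms.ModularParametrizationData W (W.conductorNorm ℤ)) (β : ℤ) (ι : K →+* ℂ), Summit.BirchSwinnertonDyer.Rank1Residual.ClassX11b W 3 → W.HasMultiplicativeReductionAtPrime 3 → Literature.NumberTheory.EllipticCurves.Rank1Residual.Surj W 3 → Literature.NumberTheory.EllipticCurves.Rank1Residual.Ram W 3 → ¬ 3 ∣ W.tamagawaProduct → Literature.NumberTheory.EllipticCurves.IsImaginaryQuadratic K → Odd (NumberField.discr K) → Literature.NumberTheory.EllipticCurves.SatisfiesHeegnerHypothesis (W.conductorNorm ℤ) K → (W.quadraticTwist (NumberField.discr K : ℚ)).entireLFunction 1 ≠ 0 → NumberField.discr K ≠ -3 → (4 * (W.conductorNorm ℤ : ℤ)) ∣ β ^ 2 - NumberField.discr K → ¬ (3 : ℤ) ∣ Dt.c → ∃ (n : ℕ) (d : Literature.NumberTheory.EllipticCurves.KolyvaginHeegnerData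 Dt β ι n), Literature.NumberTheory.EllipticCurves.KolyvaginDescent.KolSupp (Literature.NumberTheory.EllipticCurves.Zhang2014.IsKolyvaginPrime (W.conductorNorm ℤ) W K 3) n ∧ d.kolyvaginClass Nat.prime_three 1 ≠ 0

-- parent: ZhangSharpFrameAtThree · child (gen 1)
/--     item stmt-BirchSwinnertonDyer-19575 · aside · rank 202 · open
    parent: ZhangSharpFrameAtThree · by planner
    why it might fail: contains the frames with r_an(E/K) ≥ 3 (L(E^{d_K},1) = 0) and d_K even, where no printed or tree tool produces a non-zero Kolyvagin class mod 3; parked, not a target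
    sources: WZhang2014, McCallumLMS1991
[support] PARKED complement of the HL child: the old ∀-frame 19153 on the frames the HL child does
not cover (¬ClassX11b W 3, or d_K even, or L(E^{d_K},1) = 0 — there r_an(E/K) ≥ 3 and no printed or
tree tool applies). NOT needed by the HL kernel `Koly.bsdp_three_onA1_of_kolyvaginFramesHL`; exists
only so that HL ∧ OffHL ⟹ 19153 (glue by cases) while `closes` still consumes 19153; becomes moot
when the operator applies plan/D2 (closes through the HL child, 19153 → aside). Do not claim. -/
@[route_item "route-BirchSwinnertonDyer-KolyvaginRoadThree"]
def ZhangFrameOffHLAtThree : Prop :=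
  ∀ (W : WeierstrassCurve ℚ) [W.IsElliptic] [W.IsGloballyMinimal] [NeZero (W.conductorNorm ℤ)] (K : Type) [Field K] [NumberField K] (Dt : Literature.NumberTheory.EllipticCurves.ModularForms.ModularParametrizationData W (W.conductorNorm ℤ)) (β : ℤ) (ι : K →+* ℂ), ¬ (Summit.BirchSwinnertonDyer.Rank1Residual.ClassX11b W 3 ∧ Odd (NumberField.discr K) ∧ (W.quadraticTwist (NumberField.discr K : ℚ)).entireLFunction 1 ≠ 0) → W.HasMultiplicativeReductionAtPrime 3 → Literature.NumberTheory.EllipticCurves.Rank1Residual.Surj W 3 → Literature.NumberTheory.EllipticCurves.Rank1Residual.Ram W 3 → ¬ 3 ∣ W.tamagawaProduct → Literature.NumberTheory.EllipticCurves.IsImaginaryQuadratic K → Literature.NumberTheory.EllipticCurves.SatisfiesHeegnerHypothesis (W.conductorNorm ℤ) K → NumberField.discr K ≠ -3 → (4 * (W.conductorNorm ℤ : ℤ)) ∣ β ^ 2 - NumberField.discr K → ¬ (3 : ℤ) ∣ Dt.c → ∃ (n : ℕ) (d : Literature.NumberTheory.EllipticCurves.KolyvaginHeegnerData Dt β ι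 n), Literature.NumberTheory.EllipticCurves.KolyvaginDescent.KolSupp (Literature.NumberTheory.EllipticCurves.Zhang2014.IsKolyvaginPrime (W.conductorNorm ℤ) W K 3) n ∧ d.kolyvaginClass Nat.prime_three 1 ≠ 0

-- parent: ZhangSharpFrameAtThree · glue (gen 1)
/--     item stmt-BirchSwinnertonDyer-19576 · support · rank 203 · closed · proved by Summit.BirchSwinnertonDyer.BirchSwinnertonDyer.Theorems.kolyvaginRoadThree_zhangSharpFrameAtThreeOfHLChildren_holds (prover)
    parent: ZhangSharpFrameAtThree · GLUE: children ⟹ parent · by planner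
glue for the split of ZhangSharpFrameAtThree: the children imply the parent -/
@[route_item "route-BirchSwinnertonDyer-KolyvaginRoadThree"]
def ZhangSharpFrameAtThreeOfHLChildren : Prop :=
  ZhangSharpFrameAtThreeHL → ZhangFrameOffHLAtThree → ZhangSharpFrameAtThree

-- `ZhangSharpFrameAtThreeOfHLChildren` holds: proved by `Summit.BirchSwinnertonDyer.BirchSwinnertonDyer.Theorems.kolyvaginRoadThree_zhangSharpFrameAtThreeOfHLChildren_holds` (its module imports this route file, so no `_holds` link can be stated here).

/-- item stmt-BirchSwinnertonDyer-23334 · aside · rank 3 · open · by planner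
why it might fail: published IMC containments exclude p = 3 with 3 || N in the needed generality (SU14 p >= 5; BCS24 Eisenstein case only); a positive anticyclotomic mu at 3 on some residual shape would break the divisibility as typed
sources: SkinnerUrban2014, Wan2020, CastellaGrossiLeeSkinner2022, BurungaleCastellaSkinner2024
[crux] RULING 73 (planner bsd-stepL g42): the ONE beyond-print input of crux 19109
EulerHalvesAtThree after tam3-p1 g19's r21 items-closer p657849 (binder hRes): the
Iwasawa-main-conjecture CONTAINMENT half (char of the anticyclotomic/BDP Selmer side DIVIDES the
p-adic L-function side, i.e. the Euler-system direction's converse) at p = 3 with 3 exactly dividing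
N, on the residual SHAPES left after the 3-anchor cut of line inert (multiplicative at 3, E[3]
irreducible, the co-step-L residual classes) — stated BY NAME over tam3-p1's Defs module. With it +
print facts + x11a at 3 + the route items, 19109 closes (p657849). why it might fail: at p = 3 the
published IMC proofs (Skinner-Urban 2014 Thm 3.29, Wan 2020, Castella-Grossi-Lee-Skinner 2022,
Burungale-Castella-Skinner 2024) assume p >= 5 or exclude 3 || N with E[3] reducible/irreducible
small-image cases; anticyclotomic mu-invariants at 3 can be positive (Vatsal 2003 only for p >= 5 in
places) — the (B6)-type territory at 3. sources: SkinnerUrban2014 Thm 3.29/3.6; Wan2020;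
CastellaGrossiLeeSkinner2022; BurungaleCastellaSkinner2024 (p = 3 Eisenstein); tam3-p1 g19 memo +
Defs docstring. RE-ADDED (plan g43, RULING 77 (c)) after the R -/
@[route_item "route-BirchSwinnertonDyer-KolyvaginRoadThree"]
def EulerHalvesAtThreeCoStepLResidual : Prop :=
  Summit.BirchSwinnertonDyer.BirchSwinnertonDyer.Theorems.EulerHalvesAtThreeCoStepLResidual

/-- item stmt-BirchSwinnertonDyer-19155 · aside · rank 4 · SPLIT (gen 1) into ValueContinuityAtThree, IMCDivTwoLociTamAtThree + glue HalvesTamAtThreeOfChildren · direct attempts still welcome (low priority) · by planner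
why it might fail: H3 at p = 3: the Eisenstein-congruence machinery (Skinner–Urban ∕ Wan) needs p ≥ 5 for μ = 0 and big-image lemmas on GU(3,1); at 3 the anticyclotomic μ-invariant of L_3^BDP may be positive (Kim–Ohta type phenomena); the split-3 clause sits in the exceptional-zero regime.
sources: Castella2018, Castella2018Erratum, Hsieh2014, arXiv:2107.13726
[crux] roads (b)/(d) OFF A1: for E ∈ X11b at 3, on (3 split ∧ (ram) ∧ 3 ∣ ∏c) and on (¬(ram) ∧ ρ̄
onto), both STEP-L halves at 3 hold — the BDP value formula `Three.BDPValueAt₃ W` (H2, THEOREM C ∕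
C♯ of the cell: memo-proved and refereed) and the main-conjecture divisibility `Three.IMCDivAt₃ W`
(H3, open) — ClassRecordThree's HalvesAtThree (item 19107) with the Tamagawa binder added in the
(ram) clause; implied by it (`halvesTamAtThree_of`). [difficulty: open-problem] -/
@[route_item "route-BirchSwinnertonDyer-KolyvaginRoadThree"]
def HalvesTamAtThree : Prop :=
  ∀ (W : WeierstrassCurve ℚ) [W.IsElliptic] [W.IsGloballyMinimal], Summit.BirchSwinnertonDyer.Rank1Residual.ClassX11b W 3 → (Literature.NumberTheory.EllipticCurves.Rank1Residual.Ram W 3 → W.HasSplitMultiplicativeReductionAtPrime 3 → 3 ∣ W.tamagawaProduct → Summit.BirchSwinnertonDyer.Rank1Residual.X11b.Three.BDPValueAt₃ W ∧ Summit.BirchSwinnertonDyer.Rank1Residual.X11b.Three.IMCDivAt₃ W) ∧ (¬ Literature.NumberTheory.EllipticCurves.Rank1Residual.Ram W 3 → Literature.NumberTheory.EllipticCurves.Rank1Residual.Surj W 3 → Summit.BirchSwinnertonDyer.Rank1Residual.X11b.Three.BDPValueAt₃ W ∧ Summit.BirchSwinnertonDyer.Rank1Residual.X11b.Three.IMCDivAt₃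 W)

-- parent: HalvesTamAtThree · child (gen 1)
/--     item stmt-BirchSwinnertonDyer-19493 · aside · rank 401 · open
    parent: HalvesTamAtThree · by planner
    why it might fail: printed value formulas (BDP 2013 Thm 5.13, Castella–Hsieh 2018 Thm 4.9, Castella 2018 Thm 2.11, LZZ 2018) need p ∤ N or p ≥ 5; at p = 3 ∣ N the anticyclotomic L-function may not extend continuously to the trivial character (U_3-stabilisation, exceptional-zero ℒ-factor): the limit can fail
    sources: BertoliniDarmonPrasanna2013, CastellaHsieh2018, Castella2018, Castella2018Exceptional, LiuZhangZhang2018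
[crux] (VC₃) VALUE CONTINUITY AT THE TRIVIAL CHARACTER, class-wide on X11b@3 ∧ Surj: for every
minimal W with ClassX11b W 3 and surjective ρ̄_{E,3}, every Heegner frame (N, K, Dt, H, ι, P
non-torsion, L(E^{d_K},1) ≠ 0, 3 ∤ c), every anticyclotomic ℤ₃-extension κ with topological
generator γ, every degree-one prime 𝔭 | 3 of K, newform f of E and ι' : Q̄₃^alg ≃ ℂ inducing 𝔭,
there are periods Ω_K ≠ 0, Ω_p ≠ 0 and a unit u of the unramified integers such that along EVERY
sequence of unramified Hecke characters φ_k of infinity type (n_k, −n_k), n_k > 0, with 3-adic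
avatars r_k factoring through κ and r_k(γ) → 1, the normalised BDP interpolation values
ι'⁻¹(L^{BDP}_𝔭(f, φ_k, Ω_K))·Ω_p^{4 n_k} converge 3-adically to u·((1 − a_3(E)·3⁻¹)·log_{ω_E} P)² —
the p = 3, 3 ∣ N analogue of the BDP formula at the trivial character read as a CONTINUITY statement
(Bertolini–Darmon–Prasanna 2013 Thm. 5.13; Castella–Hsieh 2018 Prop. 3.6 / Thm. 4.9; Castella 2018
Thms. 2.10–2.11 = arXiv:1507.04260; Liu–Zhang–Zhang 2018 Thm. 3.10). It is EXACTLY the hypothesis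
`hVC` of thmc-p1's landed theorems `classRecordThree_halvesAtThree_of_valueContinuity_of_imcDivStub`
(p421546, Theorems/ClassRecordThreeHalvesAtTh -/
@[route_item "route-BirchSwinnertonDyer-KolyvaginRoadThree"]
def ValueContinuityAtThree : Prop :=
  ∀ (W : WeierstrassCurve ℚ) [W.IsElliptic] [W.IsGloballyMinimal], ∀ (N : ℕ) [NeZero N] (K : Type) [Field K] [NumberField K] (Dt : Literature.NumberTheory.EllipticCurves.ModularForms.ModularParametrizationData W N) (H : Literature.NumberTheory.EllipticCurves.HeegnerDatum N (NumberField.discr K)) (ι : K →+* ℂ) (P : (W.baseChange K).toAffine.Point), Summit.BirchSwinnertonDyer.Rank1Residual.ClassX11b W 3 → Literature.NumberTheory.EllipticCurves.Rank1Residual.Surj W 3 → W.conductorNorm ℤ = N → Literature.NumberTheory.EllipticCurves.IsImaginaryQuadratic K → Odd (NumberField.discr K) → Literature.NumberTheory.EllipticCurves.SatisfiesHeegnerHypothesis N K → (W.quadraticTwist (NumberField.discr K : ℚ)).entireLFunction 1 ≠ 0 → WeierstrassCurve.Affine.Point.map ι.toRatAlgHom P = Literature.NumberTheory.EllipticCurves.ModularForms.heegnerPointComplex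 Dt H → ¬ (3 : ℤ) ∣ Dt.c → ¬ IsOfFinAddOrder P → ∀ (κ : Literature.NumberTheory.EllipticCurves.ZpExtension K 3), κ.IsAnticyclotomic → ∀ (γ : Field.absoluteGaloisGroup K) [Fact (κ.IsTopGenerator γ)] (𝔭 : IsDedekindDomain.HeightOneSpectrum (NumberField.RingOfIntegers K)) (h𝔭 : ((3 : ℕ) : NumberField.RingOfIntegers K) ∈ 𝔭.asIdeal) (he : 𝔭.asIdeal.ramificationIdx (NumberField.RingOfIntegers ℚ) = 1) (hf : 𝔭.asIdeal.inertiaDeg (NumberField.RingOfIntegers ℚ) = 1), ∀ (f : CuspForm (CongruenceSubgroup.Gamma0 N) 2), Literature.NumberTheory.EllipticCurves.ModularForms.IsNewformOf W f → ∀ (ι' : PadicAlgCl 3 ≃+* ℂ), Summit.BirchSwinnertonDyer.Rank1Residual.X11b.Three.InducesPrime ι' 𝔭 → ∃ (ΩK : ℂ) (Ωp : ℂ_[3]) (u : (Literature.NumberTheory.EllipticCurves.unrIntegers 3)ˣ), ΩK ≠ 0 ∧ Ωp ≠ 0 ∧ ∀ (φ : ℕ → Literature.NumberTheory.GaloisRepresentations.HeckeCharacter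 K) (n : ℕ → ℕ) (r : ℕ → Literature.NumberTheory.GaloisRepresentations.FramedGaloisRep K (PadicAlgCl 3) 1), (∀ k, 0 < n k) → (∀ k (v : IsDedekindDomain.HeightOneSpectrum (NumberField.RingOfIntegers K)), (φ k).IsUnramifiedAt v) → (∀ k, (φ k).HasInfinityType (fun _ ↦ (n k : ℤ)) (fun _ ↦ -(n k : ℤ))) → (∀ k, Literature.NumberTheory.EllipticCurves.IsPAdicAvatarOf ι' (φ k) (r k)) → (∀ k, Literature.NumberTheory.EllipticCurves.FactorsThroughZp κ (r k)) → Filter.Tendsto (fun k ↦ Literature.NumberTheory.EllipticCurves.avatarValueAt (r k) γ) Filter.atTop (nhds 1) → Filter.Tendsto (fun k ↦ ((ι'.symm (Literature.NumberTheory.EllipticCurves.bdpInterpolationValue 3 f 𝔭 (φ k) (n k) ΩK) : PadicAlgCl 3) : ℂ_[3]) * Ωp ^ (4 * n k)) Filter.atTop (nhds (((u : Literature.NumberTheory.EllipticCurves.unrIntegers 3) : ℂ_[3]) * (algebraMap ℚ_[3] ℂ_[3] (((1 : ℚ_[3]) - ((W.LFunction 3 : ℤ) : ℚ_[3]) * (3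 : ℚ_[3])⁻¹) * Summit.BirchSwinnertonDyer.Rank1Residual.X11b.Halves.logOmega W 3 (Summit.BirchSwinnertonDyer.Rank1Residual.X11b.embAt K 3 𝔭 h𝔭 he hf) P)) ^ 2))

-- parent: HalvesTamAtThree · child (gen 1)
/--     item stmt-BirchSwinnertonDyer-19506 · aside · rank 402 · open
    parent: HalvesTamAtThree · by planner
    why it might fail: no printed BDP-side divisibility at p = 3: Wan 2020 Thm 1.1, Castella 2018 Thm 4.4, Skinner–Urban 2014 assume p ≥ 5 / p-distinguished; at 3 ‖ N the U_p-level modifications and Eischen–Wan tame datum are unavailable, and a μ-invariant or missing Ihara lemma at 3 could cost a power of 3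
    sources: Castella2018, Wan2020, SkinnerUrban2014, FouquetWan2021, Skinner2016PacificMC
[crux] (H3 on the two HALVES loci of the Kolyvagin road, i.e. with the extra binder 3 ∣ ∏c_ℓ on the
ramified locus) the BDP-side anticyclotomic MAIN-CONJECTURE DIVISIBILITY at p = 3, `Three.IMCDivAt₃
W` (StepLHalves.lean: every unramified power series L with the BDP interpolation property divides
the base change of Ch_Λ(X_ac^∅) in R₀⟦T⟧ — Castella 2018 §1 (1.b) / Thm. 4.4 shape, from Wan 2020
Thm. 1.1 and Fouquet–Wan Thm. 4.41), for every minimal W with ClassX11b W 3: (i) on the ramified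
locus Ram W 3 under split multiplicative reduction at 3 and 3 ∣ ∏c, and (ii) on the unramified locus
¬Ram W 3 under Surj W 3. It is EXACTLY the hypothesis `h3` of thmc-p1's landed theorem
`kolyvaginRoadThree_halvesTamAtThree_of_valueContinuity_of_imcDivTamStub` (p422252); together with
the sibling child `ValueContinuityAtThree` that theorem closes the glue. [difficulty: XL]
[technique: Eisenstein congruences on U(3,1) / Rankin–Selberg (Wan), Beilinson–Flach or
Heegner-point Kolyvagin systems at p = 3] -/
@[route_item "route-BirchSwinnertonDyer-KolyvaginRoadThree"]
def IMCDivTwoLociTamAtThree : Prop :=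
  ∀ (W : WeierstrassCurve ℚ) [W.IsElliptic] [W.IsGloballyMinimal], Summit.BirchSwinnertonDyer.Rank1Residual.ClassX11b W 3 → (Literature.NumberTheory.EllipticCurves.Rank1Residual.Ram W 3 → W.HasSplitMultiplicativeReductionAtPrime 3 → 3 ∣ W.tamagawaProduct → Summit.BirchSwinnertonDyer.Rank1Residual.X11b.Three.IMCDivAt₃ W) ∧ (¬ Literature.NumberTheory.EllipticCurves.Rank1Residual.Ram W 3 → Literature.NumberTheory.EllipticCurves.Rank1Residual.Surj W 3 → Summit.BirchSwinnertonDyer.Rank1Residual.X11b.Three.IMCDivAt₃ W)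

-- parent: HalvesTamAtThree · glue (gen 1)
/--     item stmt-BirchSwinnertonDyer-19507 · support · rank 403 · closed · proved by Summit.BirchSwinnertonDyer.BirchSwinnertonDyer.Theorems.halvesTamAtThreeOfChildren_holds (prover)
    parent: HalvesTamAtThree · GLUE: children ⟹ parent · by planner
HalvesTamAtThree ⇐ ValueContinuityAtThree (VC₃, the child shared with
ClassRecordThree.HalvesAtThree) → IMCDivTwoLociTamAtThree (BDP-side IMC divisibility at 3 on the two
Koly halves loci, with the 3 ∣ ∏c binder); the glue item is closed VERBATIM by the landed theorem
Summit.BirchSwinnertonDyer.BirchSwinnertonDyer.Theorems.kolyvaginRoadThree_halvesTamAtThree_of_valueContinuity_of_imcDivTamStub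
(thmc-p1 p422252; term `fun hVC h3 ↦ … hVC h3`, farm rc 0 in the planner Sketch-D3.lean) — a hand
lands it as `halvesTamAtThreeOfChildren_holds`. -/
@[route_item "route-BirchSwinnertonDyer-KolyvaginRoadThree"]
def HalvesTamAtThreeOfChildren : Prop :=
  ValueContinuityAtThree → IMCDivTwoLociTamAtThree → HalvesTamAtThree

-- `HalvesTamAtThreeOfChildren` holds: proved by `Summit.BirchSwinnertonDyer.BirchSwinnertonDyer.Theorems.halvesTamAtThreeOfChildren_holds` (its module imports this route file, so no `_holds` link can be stated here).

/-- item stmt-BirchSwinnertonDyer-20253 · aside · rank 4 · open · by planner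
why it might fail: H3 at p = 3, RE-ORIENTED (X-slot at the prime conjugate to the frame prime): the Eisenstein-congruence ∕ Wan machinery needs p ≥ 5 for μ = 0 and big image on GU(3,1); at 3 the anticyclotomic μ of L_3^BDP may be positive (Kim–Ohta); one class-3 datum with Ch(X_ac)_{𝔭bar} ⊄ (L_𝔭) refutes it.
sources: Castella2018, Castella2018Erratum, Hsieh2014, arXiv:2107.13726, BDP2013
[crux] the two named S24-b halves at 3 on the two loci of class X11b@3, RE-ORIENTED (repairs 19155
`HalvesTamAtThree`): on (ram: 3 split mult, 3 ∣ ∏c_ℓ) and on (¬ram: ρ̄ onto), the BDP value formula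
`Three.BDPValueAt₃ W` and the BDP-side IMC divisibility `Three.IMCDivAt₃B W` — Ch_Λ(X_ac)_{𝔭bar} ·
Λ^ur ⊆ (L_𝔭) with the X-slot at the prime 𝔭bar CONJUGATE to the frame prime 𝔭 (Castella Thm 2.x ∕
BDP ∕ erratum (5.3) orientation). -/
@[route_item "route-BirchSwinnertonDyer-KolyvaginRoadThree"]
def HalvesTamAtThreeR : Prop :=
  ∀ (W : WeierstrassCurve ℚ) [W.IsElliptic] [W.IsGloballyMinimal], Summit.BirchSwinnertonDyer.Rank1Residual.ClassX11b W 3 → (Literature.NumberTheory.EllipticCurves.Rank1Residual.Ram W 3 → W.HasSplitMultiplicativeReductionAtPrime 3 → 3 ∣ W.tamagawaProduct → Summit.BirchSwinnertonDyer.Rank1Residual.X11b.Three.BDPValueAt₃ W ∧ Summit.BirchSwinnertonDyer.Rank1Residual.X11b.Three.IMCDivAt₃B W) ∧ (¬ Literature.NumberTheory.EllipticCurves.Rank1Residual.Ram W 3 → Literature.NumberTheory.EllipticCurves.Rank1Residual.Surj W 3 → Summit.BirchSwinnertonDyer.Rank1Residual.X11b.Three.BDPValueAt₃ W ∧ Summit.BirchSwinnertonDyer.Rank1Residual.X11b.Three.IMCDivAt₃B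 W)

/-- item stmt-BirchSwinnertonDyer-23422 · aside · rank 4 · open · by planner
why it might fail: Cartan road: the saved Heegner display / degree law at a non-split Cartan place (K1) is not in print and p = 3 meets #Aut and anomalous-prime exclusions; off-road: IMC containment at p = 3 with 3 || N is beyond SU14 (p >= 5)
sources: GrossZagier1986, Kolyvagin1990, Jetchev2008, SkinnerUrban2014
[crux] RULING 78 (α) (planner bsd-stepL g43; tam3-p1 g19 option α): the residue of crux 19109
EulerHalvesAtThree in OUTPUT form — for every X11b curve W at p = 3 with Surj W 3, multi-carrier and
in residual normal form (Three.MultiCarrierAt W, Three.ResidualNormalFormAt W: the classes left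
after line inert's 3-anchor cut), the typed Selmer/index bound Typed.MissingUpperBoundAt W 3. Stated
BY NAME over tam3-p1's Defs module (p665127). It is implied by the IMC-form residue 23334
EulerHalvesAtThreeCoStepLResidual (closer residualUpperBound_of_items_of_coStepLResidual, p665485 =
line costepl, zero stubs) and, independently, by the Cartan road Three.CartanRoadAtThree plus the
off-Cartan residue (…_of_cartanRoad_of_coStepLOffCartan = line cartan; road derived from its
displayed inputs by CartanKernel.cartanRoadAtThree_of_inputs p662140; bsd-idea-10 g8 reports the
off-Cartan residue EMPTY, Theorems proof pending). With it + the seven other route items, 19109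
closes (eulerHalvesAtThree_of_items_of_residualUpperBound, p665485). why it might fail: on the
Cartan road the SAVED-display degree law at a Cartan place (K1) is open in print and the Kolyvagin
bound needs the E′-road Heegner display -/
@[route_item "route-BirchSwinnertonDyer-KolyvaginRoadThree", crux]
def EulerHalvesAtThreeResidualUpperBound : Prop :=
  Summit.BirchSwinnertonDyer.BirchSwinnertonDyer.Theorems.EulerHalvesAtThreeResidualUpperBound

/-- item stmt-BirchSwinnertonDyer-19108 · aside · rank 5 · SPLIT (gen 1) into TateSenVanishingAtThree, OpenValueReciprocityAtThree + glue HsiehDescentAtThreeOfChildren · direct attempts still welcome (low priority) · by planner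
why it might fail: anticyclotomic control at p = 3 with 3 ∥ N meets a possibly non-trivial error term from E(ℚ₃)[3] and the component group (c₃ may be divisible by 3 on the split locus), which the p ≥ 5 proofs (JSW §3) kill by hypothesis.
sources: JetchevSkinnerWan2017, Hsieh2014, GreenbergLNM1716
retired/moot children: OpenValueReciprocityAtThree [replaced: ∀ (W : WeierstrassCurve ℚ) [W.IsElliptic], ∀ (ι' : PadicAlgCl 3 ≃+* ℂ) (K : Type]
[crux] the named S24-b descent residual `Three.HsiehDescentAt₃ W` on the same two loci: from the two
halves at 3 to the 3-part of the BSD formula over K and down to ℚ (control of the anticyclotomic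
Selmer group at 3 ∥ N, the local condition at 3, and the twist descent), a step printed nowhere at p
= 3. [deps: HalvesAtThree] [difficulty: L] -/
@[route_item "route-BirchSwinnertonDyer-KolyvaginRoadThree"]
def HsiehDescentAtThree : Prop :=
  ∀ (W : WeierstrassCurve ℚ) [W.IsElliptic] [W.IsGloballyMinimal], Summit.BirchSwinnertonDyer.Rank1Residual.ClassX11b W 3 → (Literature.NumberTheory.EllipticCurves.Rank1Residual.Ram W 3 → W.HasSplitMultiplicativeReductionAtPrime 3 → Summit.BirchSwinnertonDyer.Rank1Residual.X11b.Three.HsiehDescentAt₃ W) ∧ (¬ Literature.NumberTheory.EllipticCurves.Rank1Residual.Ram W 3 → Literature.NumberTheory.EllipticCurves.Rank1Residual.Surj W 3 → Summit.BirchSwinnertonDyer.Rank1Residual.X11b.Three.HsiehDescentAt₃ W)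

-- parent: HsiehDescentAtThree · child (gen 1)
/--     item stmt-BirchSwinnertonDyer-19281 · crux · rank 502 · open
    parent: HsiehDescentAtThree · by planner
    why it might fail: the assembled σ-equivariance is printed nowhere (x11b3 L72 (α)): [T1]+[T2] need the CM-test-triple ∕ algebraic-δ^n front and the match of `bdpInterpolationValue` with BDP's L(f,χ⁻¹,0)∕Ω^{4n} normalisation; an n-dependent transcendental factor in Ω would falsify the clause as typed.
    sources: BertoliniDarmonPrasanna2013
[crux] K5-B of the cell in SHARP form (TARGET §1.1 (R-b); PROOF-BDP §18; bdp g10 p417285): for every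
globally minimal elliptic W of class X11b at 3 with ρ̄_{E,3} onto, newform f of W, imaginary
quadratic Heegner field K with d_K ODD and 3 split, (Heeg) clause, prime 𝔭 | 3 of K matched to ι′,
anticyclotomic κ: there are Ω ≠ 0 and m ≥ 1 with 3 ∤ m such that the BDP interpolation values
`bdpInterpolationValue 3 f 𝔭 χ n Ω` (χ unramified of infinity type (n, −n), factoring through κ)
satisfy EXACT Aut(ℂ/ℚ)-reciprocity σ(V(χ)) = V(χ^σ) for every σ lying over a τ ∈ G_{ℚ_3(μ_m)} —
VERBATIM the hypothesis `hVR` of the landed SHARP reduction p417285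
(`BdpSeat.classRecordThree_hsiehDescentAtThree_of_tateSenCharacter_of_sharpValueReciprocity`) = def
`Theorems.ValueReciprocityBAtThree` (p417714, `Theorems/ClassRecordThreeDefs.lean`); print-derivable
from BDP13 Prop 1.12 (1) ∕ (5.1.16) ∕ Thm 5.4 ∕ Lemma 5.3 (standing hypothesis c·d_K odd — now
INSIDE the binder) with Hida–Tilouine 1993 Thm 1.1 ∕ Katz 1978 (2.4.5) (Ω = Katz's Ω_K, H(i)
unramified above 3); strictly WEAKER than the unsharp `OpenValueReciprocityAtThree` (four hypotheses
added); the layer-2 deciding piece of item 19108. [deps: Hsieh -/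
@[route_item "route-BirchSwinnertonDyer-KolyvaginRoadThree", crux]
def OpenValueReciprocityAtThree : Prop :=
  ∀ (W : WeierstrassCurve ℚ) [W.IsElliptic] [W.IsGloballyMinimal], ∀ (ι' : PadicAlgCl 3 ≃+* ℂ) (K : Type) [Field K] [NumberField K] (𝔭 : IsDedekindDomain.HeightOneSpectrum (NumberField.RingOfIntegers K)) (κ : Literature.NumberTheory.EllipticCurves.ZpExtension K 3) {N : ℕ} [NeZero N] (f : CuspForm (CongruenceSubgroup.Gamma0 N) 2), Literature.NumberTheory.EllipticCurves.ModularForms.IsNewformOf W f → Summit.BirchSwinnertonDyer.Rank1Residual.ClassX11b W 3 → Literature.NumberTheory.EllipticCurves.Rank1Residual.Surj W 3 → W.conductorNorm ℤ = N → Literature.NumberTheory.EllipticCurves.IsImaginaryQuadratic K → Odd (NumberField.discr K) → Literature.NumberTheory.EllipticCurves.SatisfiesHeegnerHypothesis N K → ((Ideal.span {(3 : ℤ)}).primesOver (NumberField.RingOfIntegers K)).ncard = 2 → ((3 : ℕ) : NumberField.RingOfIntegers K) ∈ 𝔭.asIdeal → 𝔭.asIdeal.ramificationIdx (NumberField.RingOfIntegers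 ℚ) = 1 → 𝔭.asIdeal.inertiaDeg (NumberField.RingOfIntegers ℚ) = 1 → (∀ (w : NumberField.InfinitePlace K) (k : NumberField.RingOfIntegers K), k ∈ 𝔭.asIdeal ↔ ‖ι'.symm (w.embedding (k : K))‖ < 1) → (∀ ℓ : ℕ, ℓ.Prime → ℓ ∣ N → ∃ v : IsDedekindDomain.HeightOneSpectrum (NumberField.RingOfIntegers K), Ideal.absNorm v.asIdeal = ℓ) → κ.IsAnticyclotomic → ∃ Ω : ℂ, Ω ≠ 0 ∧ ∃ m : ℕ, 0 < m ∧ ¬ 3 ∣ m ∧ (∀ (τ : PadicAlgCl 3 ≃ₐ[ℚ_[3]] PadicAlgCl 3) (σ : ℂ ≃ₐ[ℚ] ℂ), (∀ ζ : PadicAlgCl 3, ζ ^ m = 1 → τ ζ = ζ) → (∀ z : PadicAlgCl 3, σ (ι' z) = ι' (τ z)) → ∀ (χ : Literature.NumberTheory.GaloisRepresentations.HeckeCharacter K) (n : ℕ), 0 < n → (∀ v : IsDedekindDomain.HeightOneSpectrum (NumberField.RingOfIntegers K), χ.IsUnramifiedAt v) → ∀ hχ : χ.HasInfinityType (fun _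 ↦ (n : ℤ)) (fun _ ↦ -(n : ℤ)), ∀ r : Literature.NumberTheory.GaloisRepresentations.FramedGaloisRep K (PadicAlgCl 3) 1, Literature.NumberTheory.EllipticCurves.IsPAdicAvatarOf ι' χ r → Literature.NumberTheory.EllipticCurves.FactorsThroughZp κ r → σ (Literature.NumberTheory.EllipticCurves.bdpInterpolationValue 3 f 𝔭 χ n Ω) = Literature.NumberTheory.EllipticCurves.bdpInterpolationValue 3 f 𝔭 (hχ.autConj σ) n Ω)

-- parent: HsiehDescentAtThree · child (gen 1)
/--     item stmt-BirchSwinnertonDyer-19238 · support · rank 501 · open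
    parent: HsiehDescentAtThree · by planner
    sources: BrinonConrad2009
[support] the PRINTED Tate–Sen theorem at p = 3 as the tree's named Literature fact
`TateSenCharacterVanishing 3` (H⁰(G_F, ℂ_3(η)) = 0 for F = ℚ_3(μ_m), η of infinite inertial image;
Brinon–Conrad Thm 2.2.7 = Tate 1967 §3.3 Thm 2; landed p414875) — cite-only input of the glue
`TateSenVanishingAtThree → OpenValueReciprocityAtThree → HsiehDescentAtThree` (glue-by
`Theorems.classRecordThree_hsiehDescentAtThree_of_tateSenCharacter_of_openValueReciprocity`,
p416145). [deps: none] [difficulty: provable-now modulo the named fact] -/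
@[route_item "route-BirchSwinnertonDyer-KolyvaginRoadThree", crux]
def TateSenVanishingAtThree : Prop :=
  Literature.NumberTheory.PAdicHodge.TateSenCharacterVanishing 3

-- parent: HsiehDescentAtThree · glue (gen 1)
/--     item stmt-BirchSwinnertonDyer-19240 · support · rank 503 · closed · proved by Summit.BirchSwinnertonDyer.BirchSwinnertonDyer.Theorems.hsiehDescentAtThreeOfChildren_holds (prover)
    parent: HsiehDescentAtThree · GLUE: children ⟹ parent · by planner
closed at once by the landed reduction
Summit.BirchSwinnertonDyer.BirchSwinnertonDyer.Theorems.classRecordThree_hsiehDescentAtThree_of_tateSenCharacter_of_openValueReciprocity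
(p416145, bdp g9): a 3-line Theorems wrapper `fun h₁ h₂ ↦ <that theorem> h₁ h₂` (term farm-checked
by the planner in plan/D0059/split-19108/GlueTest.lean for both route copies); --glue-by is unusable
because that Theorems module imports this route file -/
@[route_item "route-BirchSwinnertonDyer-KolyvaginRoadThree"]
def HsiehDescentAtThreeOfChildren : Prop :=
  TateSenVanishingAtThree → OpenValueReciprocityAtThree → HsiehDescentAtThree

-- `HsiehDescentAtThreeOfChildren` holds: proved by `Summit.BirchSwinnertonDyer.BirchSwinnertonDyer.Theorems.hsiehDescentAtThreeOfChildren_holds` (its module imports this route file, so no `_holds` link can be stated here).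

/-- item stmt-BirchSwinnertonDyer-24801 · aside · rank 5 · open · by planner
why it might fail: Not in print: the referee-vetted paper proof (NUM-PROOF-SKETCH rev 3) has one non-formal input, Ihara-type saturation (SAT₃) at principal-series places (index 1 in 49∕49 computed cases only), and needs Shimura-curve Jacobians absent from the tree; a place with index 3 breaks the law.
sources: KohenPacetti2016, Rem. 3.8 and §2 (arXiv:1403.7801v3 pp. 7-8, 15), CaiShuTian2014, §1.2 p. 5 ((f,f)_U = deg f), Prop. 3.8 p. 21, VignerasLNM800, Ch. III §5, GrossLMS1991, §3, Ribet1990 (Ihara's lemma / level raising)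
[crux · research/formalisation · child of 23422's line cartan] NUM — THE ONE-PLACE DEGREE LAW AT A
NON-SPLIT CARTAN PLACE: for V in X11b@3 with rho-bar_{V,3} onto GL2(F3), N = D·M·prod_C p^2, q in C
a Cartan place (q != 3, q^2 || N, 3 | c_q: Kodaira IV/IV*), and class-minimal parametrisation data Q
at level (D, M; C) and Q' at level (D, Mq^2; C\q) (Literature CartanLevelCurveData /
CartanParametrizationData / IsMinimalFor): ord_3 Q'.deg = ord_3 Q.deg + 1. With it the registered
skeleton of 23422 (Lines/cartan v15) closes EulerHalvesAtThreeResidualUpperBound modulo its other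
items (composition: S-K1' p688715, SUPPLY p708995, (F2^0) p684808, (F5') p670426, (DIV_C) p675039,
CartanKernel p662140, residue empty p667512; (F2b♮) <-> NUM p722297). STATUS: NOT IN PRINT
(Kohen-Pacetti Rem. 3.8: no formulas known); PAPER PROOF (tam3-p1 g24 NUM-PROOF-SKETCH rev 3,
referee-vetted by bsd-idea-10 g14 NUM-VETTING: SOUND, critic V159 PASS): L = Hom_Q(J(X-bar), E0) for
the full-level-q cover is a Cartan torus lattice (multiplicity one, Rosati), the pulled-back optimal
parametrisations of the torus quotients are not divisible by 3 in L (descent lemma from E0(Q)[3] =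
0), sheet counts, S-K1' — provided -/
@[route_item "route-BirchSwinnertonDyer-KolyvaginRoadThree", crux]
def CartanOnePlaceDegreeLawAtThree : Prop :=
  Summit.BirchSwinnertonDyer.BirchSwinnertonDyer.Theorems.CartanCorrespondence.CartanOnePlaceDegreeLawAtThree

/-- item stmt-BirchSwinnertonDyer-19110 · aside · rank 7 · open · by planner
why it might fail: (U-Sh) #Ш(E/K)[3^∞] ≤ 3^{2 ord_3 [E(K):ℤP]} on a Shimura curve at p = 3 is outside every printed range (JSW Thm 4.4.1 needs p ≥ 5); Ribet–Takahashi's degree comparison has an uncontrolled factor at primes of non-split multiplicative reduction.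
sources: PastenShimura2024, CaiShuTian2014, JetchevSkinnerWan2017
[crux] (T2♯-ℝ)₃: the Shimura-curve displays `P2ShimuraDisplaysAt W 3` on the pure-β Shimura sub-atom
at 3 (3 split ∧ (ram) ∧ ¬(α) ∧ ¬(γ) ∧ 3 ∣ ∏ c_ℓ): Pasten §6 identities, degree links, real
Gross–Zagier on X_{N⁺,N⁻} and (U-Sh) at p = 3. [difficulty: L] -/
@[route_item "route-BirchSwinnertonDyer-KolyvaginRoadThree"]
def ShimuraDisplaysAtThree : Prop :=
  ∀ (W : WeierstrassCurve ℚ) [W.IsElliptic] [W.IsGloballyMinimal], Summit.BirchSwinnertonDyer.Rank1Residual.ClassX11b W 3 → Literature.NumberTheory.EllipticCurves.Rank1Residual.Ram W 3 → W.HasSplitMultiplicativeReductionAtPrime 3 → ¬ Summit.BirchSwinnertonDyer.Rank1Residual.X11b.Three.ShapeAlpha W → ¬ Summit.BirchSwinnertonDyer.Rank1Residual.X11b.Three.ShapeGamma W → 3 ∣ W.tamagawaProduct → Summit.BirchSwinnertonDyer.Rank1Residual.X11b.P2ShimuraDisplaysAt W 3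

/-- item stmt-BirchSwinnertonDyer-19111 · aside · rank 8 · open · by planner
why it might fail: with ρ̄_{E,3} irreducible but not onto (image in a normaliser of a Cartan) the mod-3 Kolyvagin classes may all vanish, and the twist supply with prescribed 3-adic behaviour is a Friedberg–Hoffstein statement with a local condition at 3 not in print.
sources: BalakrishnanEtAl2019, MatarNekovar2019, FriedbergHoffstein1995
[crux] (T4″)₃: the non-surjective corner at 3 (E ∈ X11b at 3 with ρ̄_{E,3} not onto): its STEP L
`Three.CornerStepLAt W`, its twist supply `Three.CornerTwistAt W` and its upper half
`Three.CornerUpperAt W` (0 TRUE-OPEN classes N < 5·10⁵ by per-pair certificates; class-wide open).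
[difficulty: L] -/
@[route_item "route-BirchSwinnertonDyer-KolyvaginRoadThree"]
def CornerAtThree : Prop :=
  ∀ (W : WeierstrassCurve ℚ) [W.IsElliptic] [W.IsGloballyMinimal], Summit.BirchSwinnertonDyer.Rank1Residual.X11b.Three.CornerStepLAt W ∧ Summit.BirchSwinnertonDyer.Rank1Residual.X11b.Three.CornerTwistAt W ∧ Summit.BirchSwinnertonDyer.Rank1Residual.X11b.Three.CornerUpperAt W

/-- item stmt-BirchSwinnertonDyer-19616 · aside · rank 8 · open · by planner
why it might fail: no printed proof on X_{N⁺,N⁻} at p ∣ N⁺ (any p) and none at p = 3: the transport of Kolyvagin–McCallum–Cha needs local triviality (R1)(R2) at v ∣ 3 where E has multiplicative reduction and 3-torsion phenomena (μ₃ ⊂ ℚ₃(ζ₃)) the p ≥ 5 texts exclude by hypothesis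
sources: JetchevSkinnerWan2017, Nekovar2007, CaiShuTian2014, Howard2004, Cha2005, WZhang2014
[crux · J DOWN re-declaration «JSW17-Thm441@3∣N⁺» (j-addendum-2 cd67edcd; D-AUDIT-19526c4
9b751249/45f0c81e verdict NOT PRINTED; referee C round 293 PASS; director 10:45:34Z/11:07:57Z)] the
Kolyvagin ORDER bound for Shimura–Heegner points on X_{N⁺,N⁻} at the locus p = 3, 3 ∣ N (so 3 ∣ N⁺:
3 splits in K), E[3] irreducible, N⁻ = ∏S with S even (possibly > 1): for every P ∈ E(K) and degS
carrying the Cai–Shu–Tian display (conjuncts 1–3), P non-torsion ⟹ #Ш(E/K)[3^∞] ≤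
3^{2·ord_3[E(K):ℤP]}. Previously consumed silently as conjunct 4 of the HELD support 19526; printed
STATEMENT JSW17 Thm 4.4.1, printed PROOF at this locus: none located (Nekovář 2007 = exponent bound;
Howard 2004 p ∤ N; Cha 2005/MN19 N⁻ = 1; Zhang14/Kim/SZ14 p ≥ 5). `closes` rebuilds 19526 from
PRINTED part + this slice + the fact OFF the locus and feeds the unchanged kernel consumer
`classRecordThree_shimuraUpperHalfAtThree_of_published` (kernel-free re-glue). Discharge path: Brown
2025 ch. 8 (acq-11342/11344) if it prints l ∣ N⁺ at l = 3. BC2 C→S FAIL, BC7 CLEAN, skeleton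
plan/DOWN19526/bc/skel (stubs surj / irred-non-surj image; plan-only BC5 rung S = ∅ = X₀(N), printed
Cha05 Thm 21). -/
@[route_item "route-BirchSwinnertonDyer-KolyvaginRoadThree"]
def ShimuraKolyvaginOrderBoundAtThree : Prop :=
  ∀ (W : WeierstrassCurve ℚ) [W.IsElliptic] [W.IsGloballyMinimal] (p : ℕ) [Fact p.Prime] (N : ℕ) [NeZero N] (K : Type) [Field K] [NumberField K] (S : Finset ℕ) (Dt : Literature.NumberTheory.EllipticCurves.ModularForms.ModularParametrizationData W N) (X : Literature.NumberTheory.Automorphic.ShimuraCurveData (∏ q ∈ S, q) (N / ∏ q ∈ S, q)) (W' : WeierstrassCurve ℚ) [W'.IsElliptic] (P₀ : Literature.NumberTheory.Automorphic.ShimuraParametrizationData X W'), W.conductorNorm ℤ = N → p ≠ 2 → W.HasIrreducibleModPGaloisRep p → Literature.NumberTheory.EllipticCurves.IsImaginaryQuadratic K → Even S.card → (∀ ℓ ∈ S, ℓ.Prime ∧ ℓ ∣ N ∧ ¬ ℓ ^ 2 ∣ N ∧ ((Ideal.span {(ℓ : ℤ)}).primesOver (NumberField.RingOfIntegers K)).ncard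 = 1 ∧ ¬ (ℓ : ℤ) ∣ NumberField.discr K) → (∀ ℓ : ℕ, ℓ.Prime → ℓ ∣ N → ℓ ∉ S → ((Ideal.span {(ℓ : ℤ)}).primesOver (NumberField.RingOfIntegers K)).ncard = 2) → ((Ideal.span {(p : ℤ)}).primesOver (NumberField.RingOfIntegers K)).ncard = 2 → P₀.IsMinimalFor W → p ∣ N → p = 3 → ∀ (P : (W.baseChange K).toAffine.Point) (degS : ℕ), 0 < degS → padicValNat p degS = padicValNat p P₀.deg → Literature.NumberTheory.EllipticCurves.LDerivEK W K = 8 * (Real.pi : ℂ) ^ 2 * Literature.NumberTheory.EllipticCurves.ModularForms.peterssonProduct (CongruenceSubgroup.Gamma0 N) 2 Dt.f Dt.f / ((((NumberField.Units.torsionOrder K : ℝ) / 2) ^ 2 * √|(NumberField.discr K : ℝ)| : ℝ) : ℂ) * ((P.canonicalHeight : ℂ) / (degS : ℂ)) → ¬ IsOfFinAddOrder P → Nat.card (AddCommGroup.primaryComponent (W.baseChange K).sha p) ≤ p ^ (2 * padicValNat p (AddSubgroup.zmultiples P).index)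

/-- item stmt-BirchSwinnertonDyer-19899 · aside · rank 8 · open · by planner
why it might fail: sharp #Ш[p^∞] ≤ p^{2·ord index} printed only for X₀(N) with GL₂(ℤ_p) image (Kolyvagin 90, Gross 91, McCallum 91), X_{N⁺,N⁻} at p ≥ 5 (Kim 24 Thm 4.3), p=3 on X₀(N) (Cha 05, MN19); at 3 ∣ N⁺ on a Shimura curve the condition at v ∣ 3 and mod-3-onto ⇏ 3-adic-onto (Elkies) are uncharted
sources: Kolyvagin1990, Gross1991, McCallum1991, CaiShuTian2014, Kim2024TAMS, WZhang2014
[crux · D7 RESTATEMENT of crux 19616 `ShimuraKolyvaginOrderBoundAtThree` to its `Surj` slice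
(planner g27 2026-08-26, director-bsd 18:23:03Z (2) «planner's call»; finding shim3b g0 p458849 ✓ /
p459268 ✓: both routes' `closes` consume the order bound ONLY at curves with ρ̄_{E,3} onto — a (ram)
witness forces surjectivity, `surj_of_irr_of_ram`; the ¬Surj ∧ Irr half (old stub
`stub_orderBound_irredNonSurjAtThree`) is idle, unprinted on X_{N⁺,N⁻} with 3 ∣ N⁺, and consists of
NON-semistable curves (`not_isSemistable_of_irr_of_not_surj`) already routed through CornerAtThree)]
Kolyvagin's ORDER bound for the Shimura–Heegner point of X_{N⁺,N⁻} at p = 3 ∣ N⁺ (3 split in K),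
ρ̄_{E,3} ONTO GL₂(𝔽₃): for every datum (W, N, K, S, Dt, X, W', P₀) of
`shimuraCurve_heegnerPoint_grossZagier_kolyvagin` and every P ∈ E(K), degS with the Cai–Shu–Tian
Gross–Zagier display, P non-torsion ⟹ #Ш(E/K)[3^∞] ≤ 3^(2·ord₃[E(K):ℤP]). Text = old 19616 with
`Literature.NumberTheory.EllipticCurves.Rank1Residual.Surj W 3 →` inserted after `W.conductorNorm ℤ
= N →` (= registered stub `stub_orderBound_surjAtThree` of the 19616 skeleton 84b6142d, fully
qualified). Shared by K2@3 (ClassRecordThree) and KOLY (KolyvaginRoad -/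
@[route_item "route-BirchSwinnertonDyer-KolyvaginRoadThree"]
def ShimuraKolyvaginOrderBoundAtThreeSurj : Prop :=
  ∀ (W : WeierstrassCurve ℚ) [W.IsElliptic] [W.IsGloballyMinimal] (p : ℕ) [Fact p.Prime] (N : ℕ) [NeZero N] (K : Type) [Field K] [NumberField K] (S : Finset ℕ) (Dt : Literature.NumberTheory.EllipticCurves.ModularForms.ModularParametrizationData W N) (X : Literature.NumberTheory.Automorphic.ShimuraCurveData (∏ q ∈ S, q) (N / ∏ q ∈ S, q)) (W' : WeierstrassCurve ℚ) [W'.IsElliptic] (P₀ : Literature.NumberTheory.Automorphic.ShimuraParametrizationData X W'), W.conductorNorm ℤ = N → Literature.NumberTheory.EllipticCurves.Rank1Residual.Surj W 3 → p ≠ 2 → W.HasIrreducibleModPGaloisRep p → Literature.NumberTheory.EllipticCurves.IsImaginaryQuadratic K → Even S.card → (∀ ℓ ∈ S, ℓ.Prime ∧ ℓ ∣ N ∧ ¬ ℓ ^ 2 ∣ N ∧ ((Ideal.span {(ℓ : ℤ)}).primesOver (NumberField.RingOfIntegers K)).ncard = 1 ∧ ¬ (ℓ : ℤ) ∣ NumberField.discr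 K) → (∀ ℓ : ℕ, ℓ.Prime → ℓ ∣ N → ℓ ∉ S → ((Ideal.span {(ℓ : ℤ)}).primesOver (NumberField.RingOfIntegers K)).ncard = 2) → ((Ideal.span {(p : ℤ)}).primesOver (NumberField.RingOfIntegers K)).ncard = 2 → P₀.IsMinimalFor W → p ∣ N → p = 3 → ∀ (P : (W.baseChange K).toAffine.Point) (degS : ℕ), 0 < degS → padicValNat p degS = padicValNat p P₀.deg → Literature.NumberTheory.EllipticCurves.LDerivEK W K = 8 * (Real.pi : ℂ) ^ 2 * Literature.NumberTheory.EllipticCurves.ModularForms.peterssonProduct (CongruenceSubgroup.Gamma0 N) 2 Dt.f Dt.f / ((((NumberField.Units.torsionOrder K : ℝ) / 2) ^ 2 * √|(NumberField.discr K : ℝ)| : ℝ) : ℂ) * ((P.canonicalHeight : ℂ) / (degS : ℂ)) → ¬ IsOfFinAddOrder P → Nat.card (AddCommGroup.primaryComponent (W.baseChange K).sha p) ≤ p ^ (2 * padicValNat p (AddSubgroup.zmultiples P).index)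

/-- item stmt-BirchSwinnertonDyer-19156 · support · rank 9 · SPLIT (gen 1) into SkinnerRankZeroPPart, WuthrichShaDividesAnalyticSha, RankEqAnalyticRankLeOne, EntireLFunctionRat, NewformOfEllipticCurve, HoffsteinLuoNonvanishingTwist, MazurManinConstantOddPrimes, FriedbergHoffsteinTwistInertAt, BarriosEtAlTamagawaTwistAtTwo, SkinnerMultiplicativeMainConjecture, SteinWuthrichNonsplitLeadingTerm, SteinWuthrichMultCanonicalHeight, DisegniPAdicBSDRankOneMultiplicative, ModularParametrizationSupply, HsiehAnticyclotomicPAdicLFunction, McCallumShaStructureCertificate, ClassicalInputsKolyThree + glue PublishedInputsKolyThreeOfParts · direct attempts still welcome (low priority) · by planner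
sources: McCallumLMS1991, Gross1984HeegnerPoints, GrossLMS1991, Kato2004Asterisque, Skinner2016PacificMC, SteinWuthrich2013
[support] the PUBLISHED named facts of the line as one conjunction: ClassRecordThree's twenty facts
verbatim (Gross–Zagier, Kolyvagin ×2, Skinner 2016 Thm C, Wuthrich 2014, rank = r_an ≤ 1,
modularity, newforms, Hoffstein–Luo, Mazur's Manin constant, Poitou–Tate, Friedberg–Hoffstein inert,
Barrios et al. 2025, Skinner Thm A, Stein–Wuthrich Thm 6.1 + canonical subgroup, Disegni 2020,
modular parametrisations, Matar–Nekovář, Hsieh 2014) ∧ McCallum 1991's exact structure theorem for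
Ш[p^∞] from a Kolyvagin certificate ∧ the conductor-1 Heegner-point Galois-conjugation record
(Shimura reciprocity; Gross 1984 §§3–4) ∧ seam G-a: a conductor-1 Kolyvagin–Heegner datum EXISTS on
every admissible frame (CM theory: «x₁ is rational over K₁», Gross 1984 §3, Gross 1991 §3; verbatim
the hypothesis `hKD` of p410690; to be replaced BY NAME once koly ∕ lit land the Literature fact
`exists_kolyvaginHeegnerData_one`); the Néron scaling fact is a tree THEOREM and is not listed.
[difficulty: provable-now] -/
@[route_item "route-BirchSwinnertonDyer-KolyvaginRoadThree", crux]
def PublishedInputsKolyThree : Prop :=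
  ((∀ (N : ℕ) [NeZero N] (W : WeierstrassCurve ℚ) (K : Type) [Field K] [NumberField K], Literature.NumberTheory.EllipticCurves.gross_zagier N W K) ∧ (∀ (N : ℕ) [NeZero N] (W : WeierstrassCurve ℚ) (K : Type) [Field K] [NumberField K], Literature.NumberTheory.EllipticCurves.kolyvagin N W K) ∧ (∀ (N : ℕ) [NeZero N] (W : WeierstrassCurve ℚ) (K : Type) [Field K] [NumberField K], Literature.NumberTheory.EllipticCurves.Kolyvagin1990_padicValNat_card_sha_le N W K) ∧ Literature.NumberTheory.EllipticCurves.Skinner2016.thmC_padicValRat_bsd_rank_zero ∧ Literature.NumberTheory.EllipticCurves.Wuthrich2014.sha_dvd_analyticSha ∧ Literature.NumberTheory.EllipticCurves.rank_eq_analyticRank_of_analyticRank_le_one ∧ WeierstrassCurve.hasEntireLFunction_rat ∧ Literature.NumberTheory.EllipticCurves.ModularForms.exists_isNewformOf ∧ Literature.NumberTheory.EllipticCurves.HoffsteinLuo1997_exists_twist_L_one_ne_zero ∧ Literature.NumberTheory.EllipticCurves.ModularForms.mazur_not_dvd_maninConstant_of_odd ∧ (∀ (K : Type) [Field K] [NumberField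 K], Literature.NumberTheory.GaloisCohomology.poitouTate_sum_localTatePairing_eq_zero K) ∧ Literature.NumberTheory.EllipticCurves.friedbergHoffstein_exists_twist_ne_zero_inertAt ∧ Literature.NumberTheory.EllipticCurves.BarriosEtAl2025.localTamagawaNumber_quadraticTwist_two_mem_of_goodReduction ∧ Literature.NumberTheory.EllipticCurves.Skinner2016.thmA_charIdeal_multiplicative ∧ Literature.NumberTheory.EllipticCurves.SteinWuthrich2013.thm61_nonsplitMultiplicative ∧ Literature.NumberTheory.EllipticCurves.SteinWuthrich2013.exists_isMultCanonical ∧ Literature.NumberTheory.EllipticCurves.Disegni2020.thm1_padicBSD_rankOne_multiplicative ∧ Literature.NumberTheory.EllipticCurves.ModularForms.nonempty_modularParametrizationData ∧ (∀ (N : ℕ) [NeZero N] (W : WeierstrassCurve ℚ) (K : Type) [Field K] [NumberField K], Literature.NumberTheory.EllipticCurves.MatarNekovar2019.thm03_padicValNat_card_sha_le_of_irreducible N W K) ∧ Literature.NumberTheory.EllipticCurves.hsieh2014_exists_anticyclotomicPAdicLFunction) ∧ Literature.NumberTheory.EllipticCurves.McCallum1991_pow_dvd_card_sha_primary_of_certificate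 ∧ (∀ (N : ℕ) [NeZero N] (W : WeierstrassCurve ℚ) (K : Type) [Field K] [NumberField K], Literature.NumberTheory.EllipticCurves.heegnerPointOfConductor_one_galoisConj N W K) ∧ (∀ (W : WeierstrassCurve ℚ) [W.IsElliptic] [W.IsGloballyMinimal] [NeZero (W.conductorNorm ℤ)] (K : Type) [Field K] [NumberField K] (Dt : Literature.NumberTheory.EllipticCurves.ModularForms.ModularParametrizationData W (W.conductorNorm ℤ)) (β : ℤ) (ι : K →+* ℂ), Literature.NumberTheory.EllipticCurves.IsImaginaryQuadratic K → Literature.NumberTheory.EllipticCurves.SatisfiesHeegnerHypothesis (W.conductorNorm ℤ) K → (4 * (W.conductorNorm ℤ : ℤ)) ∣ β ^ 2 - NumberField.discr K → Nonempty (Literature.NumberTheory.EllipticCurves.KolyvaginHeegnerData Dt β ι 1))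

-- parent: PublishedInputsKolyThree · child (gen 1)
/--     item stmt-BirchSwinnertonDyer-19381 · support · rank 901 · open
    parent: PublishedInputsKolyThree · by planner
    sources: Skinner2016PacificMC
[support] Skinner 2016 (Pacific J. Math. 283) Thm. C (§1, footnote 1, §2.5): the p-part of the BSD
formula in analytic rank 0 (good ordinary or multiplicative p, irreducible E[p] + ramification
hypothesis) — conjunct of PublishedInputsFive (stmt-BirchSwinnertonDyer-19066), BY NAME; same
content, filed as a split child so the head constant is item-stated (gate5 #15c one rule / readiness
rule 2026-08-15: a cite_only dep must be declared by the route); no crux statement / closes /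
tribunal / tribunal_fit change -/
@[route_item "route-BirchSwinnertonDyer-KolyvaginRoadThree"]
def SkinnerRankZeroPPart : Prop :=
  Literature.NumberTheory.EllipticCurves.Skinner2016.thmC_padicValRat_bsd_rank_zero

-- parent: PublishedInputsKolyThree · child (gen 1)
/--     item stmt-BirchSwinnertonDyer-19285 · support · rank 902 · open
    parent: PublishedInputsKolyThree · by operator
    sources: Wuthrich2014
[support] Wuthrich 2014 Prop. 21 (p. 400): #Ш[p^∞] divides the analytic Ш under the Kato-side
divisibility (reducible/any image) — conjunct of PublishedSignedInputs
(stmt-BirchSwinnertonDyer-19005), BY NAME; same content, filed as a split child so the head constant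
is item-stated (gate5 #15c one rule; readiness rule 2026-08-15: cite_only dep declared by the
route); no statement / closes / tribunal change -/
@[route_item "route-BirchSwinnertonDyer-KolyvaginRoadThree"]
def WuthrichShaDividesAnalyticSha : Prop :=
  Literature.NumberTheory.EllipticCurves.Wuthrich2014.sha_dvd_analyticSha

-- parent: PublishedInputsKolyThree · child (gen 1)
/--     item stmt-BirchSwinnertonDyer-19921 · support · rank 903 · open
    parent: PublishedInputsKolyThree · by operator
    sources: Darmon2004, GrossZagier1986, Kolyvagin1990
[support] The one PUBLISHED input the halves-glue consumes: Gross–Zagier–Kolyvagin, rank = analytic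
rank for analytic rank ≤ 1 with Ш finite (tree named fact
rank_eq_analyticRank_of_analyticRank_le_one; used by bsdp_of_missingPPartAt to turn Miller's last
clause into BSD(E,2)). Carried as a displayed PUB hypothesis; never counted as progress. The further
PRINT of the roads to the two halves (Greenberg Thm-4.1 analogues at a multiplicative prime
thm41Analogue_charValue_rankZero_numberField_anyPrime / …_split_baseChange_anyPrime, modularity) and
the referee-passed MEMO inputs (Kato ⊗ℚ at a multiplicative 2:
X5.O1.KatoMultiplicativeDivisibilityRat W 2, HOME mult/PROOF-MULT.md RC-2; Greenberg–Stevens at 2: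
greenberg_stevens W 2, mult/PROOF-GS2.md RC-4) enter the LINES under the halves (bridge
multiplicativeRankZeroAtTwo_of_muRoad, p409679), not this glue. -/
@[route_item "route-BirchSwinnertonDyer-KolyvaginRoadThree"]
def RankEqAnalyticRankLeOne : Prop :=
  Literature.NumberTheory.EllipticCurves.rank_eq_analyticRank_of_analyticRank_le_one

-- parent: PublishedInputsKolyThree · child (gen 1)
/--     item stmt-BirchSwinnertonDyer-19273 · support · rank 904 · open
    parent: PublishedInputsKolyThree · by planner
    sources: BCDTJAMS2001, SilvermanAEC2009
[support] entire continuation of L(E/ℚ, s) (modularity: Breuil–Conrad–Diamond–Taylor 2001 Thm A +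
Hecke/Shimura), BY NAME — conjunct of MultConversePublishedInputsAtTwo (19185); same content, filed
so the head constant is item-stated (#15c one rule; cite_only dep) -/
@[route_item "route-BirchSwinnertonDyer-KolyvaginRoadThree"]
def EntireLFunctionRat : Prop :=
  WeierstrassCurve.hasEntireLFunction_rat

-- parent: PublishedInputsKolyThree · child (gen 1)
/--     item stmt-BirchSwinnertonDyer-19382 · support · rank 905 · open
    parent: PublishedInputsKolyThree · by planner
    sources: DiamondShurman2005, BCDTJAMS2001
[support] Modularity Theorem, Version L (Diamond–Shurman 2005 Thm. 8.8.3; Wiles / Taylor–Wiles /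
BCDT 2001 Thm. A): every E/ℚ has a weight-2 newform f of level N_E with L(f,s) = L(E,s) — conjunct
of PublishedInputsFive (stmt-BirchSwinnertonDyer-19066), BY NAME; same content, filed as a split
child so the head constant is item-stated (gate5 #15c one rule / readiness rule 2026-08-15: a
cite_only dep must be declared by the route); no crux statement / closes / tribunal / tribunal_fit
change -/
@[route_item "route-BirchSwinnertonDyer-KolyvaginRoadThree"]
def NewformOfEllipticCurve : Prop :=
  Literature.NumberTheory.EllipticCurves.ModularForms.exists_isNewformOf

-- parent: PublishedInputsKolyThree · child (gen 1)
/--     item stmt-BirchSwinnertonDyer-19372 · support · rank 906 · open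
    parent: PublishedInputsKolyThree · by planner
    sources: HoffsteinLuo1997, Matsuno2009, BCDTJAMS2001
[aside] Hoffstein–Luo 1997 Theorem (§1, pp. 435–436), as used in Matsuno 2009 proof of Prop. 6.1: a
quadratic twist with L(E^D,1) ≠ 0 under prescribed local conditions — conjunct of
PublishedInputsFive (stmt-BirchSwinnertonDyer-19066) kept inside the k = 7 rest child
ClassicalAndTwistInputsFive and item-stated here BY NAME as an ASIDE (banked context, never staffed,
BC6-exempt) so the cite_only dep is declared (#15c); no crux statement / closes / tribunal change -/
@[route_item "route-BirchSwinnertonDyer-KolyvaginRoadThree"]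
def HoffsteinLuoNonvanishingTwist : Prop :=
  Literature.NumberTheory.EllipticCurves.HoffsteinLuo1997_exists_twist_L_one_ne_zero

-- parent: PublishedInputsKolyThree · child (gen 1)
/--     item stmt-BirchSwinnertonDyer-19383 · support · rank 907 · closed · proved by Summit.BirchSwinnertonDyer.BirchSwinnertonDyer.Theorems.ManinLocalTwoThree.MazurManinConstantOddPrimes_proof (prover)
    parent: PublishedInputsKolyThree · by planner
    sources: Mazur1978, EdixhovenManin1991
[support] Mazur 1978 Cor. 4.1 (with Edixhoven 1991 Prop. 2: c ∈ ℤ): for every odd prime p with p² ∤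
N the Manin constant is prime to p — conjunct of PublishedInputsFive
(stmt-BirchSwinnertonDyer-19066), BY NAME; same content, filed as a split child so the head constant
is item-stated (gate5 #15c one rule / readiness rule 2026-08-15: a cite_only dep must be declared by
the route); no crux statement / closes / tribunal / tribunal_fit change -/
@[route_item "route-BirchSwinnertonDyer-KolyvaginRoadThree"]
def MazurManinConstantOddPrimes : Prop :=
  Literature.NumberTheory.EllipticCurves.ModularForms.mazur_not_dvd_maninConstant_of_odd

/-- `MazurManinConstantOddPrimes` holds: proved by `Summit.BirchSwinnertonDyer.BirchSwinnertonDyer.Theorems.ManinLocalTwoThree.MazurManinConstantOddPrimes_proof`. -/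
theorem MazurManinConstantOddPrimes_holds : MazurManinConstantOddPrimes := _root_.Summit.BirchSwinnertonDyer.BirchSwinnertonDyer.Theorems.ManinLocalTwoThree.MazurManinConstantOddPrimes_proof

-- parent: PublishedInputsKolyThree · child (gen 1)
/--     item stmt-BirchSwinnertonDyer-19375 · support · rank 908 · open
    parent: PublishedInputsKolyThree · by planner
    sources: FriedbergHoffstein1995, JetchevSkinnerWan2017
[aside] Friedberg–Hoffstein 1995 Thm. B (special case): a Heegner field with a prescribed prime
INERT and L(E^{d_K},1) ≠ 0 (JSW 2017 §7.4.2, arXiv:1512.06894 p. 31, choice of K″; §4.1 (H) p. 17);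
text not held (acq-00930), cite-only — conjunct of PublishedInputsFive
(stmt-BirchSwinnertonDyer-19066) kept inside the k = 7 rest child ClassicalAndTwistInputsFive and
item-stated here BY NAME as an ASIDE (banked context, never staffed, BC6-exempt) so the cite_only
dep is declared (#15c); no crux statement / closes / tribunal change -/
@[route_item "route-BirchSwinnertonDyer-KolyvaginRoadThree"]
def FriedbergHoffsteinTwistInertAt : Prop :=
  Literature.NumberTheory.EllipticCurves.friedbergHoffstein_exists_twist_ne_zero_inertAt

-- parent: PublishedInputsKolyThree · child (gen 1)
/--     item stmt-BirchSwinnertonDyer-19401 · support · rank 909 · closed · proved by Summit.BirchSwinnertonDyer.BirchSwinnertonDyer.Theorems.kolyvaginRoadThree_barriosEtAlTamagawaTwistAtTwo_holds (prover)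
    parent: PublishedInputsKolyThree · by operator
    sources: BarriosEtAl2025
[support] Barrios–Roy–Sahajpal–Tallana–Tobin–Wiersema 2025 Thm. 5.1, rows R = I₀ of the tables
(arXiv:2501.03209 pp. 15–16): the local Tamagawa number at 2 of a quadratic twist of a curve with
good reduction at 2 — conjunct of PublishedInputsThree (stmt-BirchSwinnertonDyer-19112), BY NAME;
same content, filed as a split child so the head constant is item-stated (gate5 #15c one rule /
readiness rule 2026-08-15: a cite_only dep must be declared by the route); no crux statement /
closes / tribunal / tribunal_fit change -/
@[route_item "route-BirchSwinnertonDyer-KolyvaginRoadThree"]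
def BarriosEtAlTamagawaTwistAtTwo : Prop :=
  Literature.NumberTheory.EllipticCurves.BarriosEtAl2025.localTamagawaNumber_quadraticTwist_two_mem_of_goodReduction

-- `BarriosEtAlTamagawaTwistAtTwo` holds: proved by `Summit.BirchSwinnertonDyer.BirchSwinnertonDyer.Theorems.kolyvaginRoadThree_barriosEtAlTamagawaTwistAtTwo_holds` (its module imports this route file, so no `_holds` link can be stated here).

-- parent: PublishedInputsKolyThree · child (gen 1)
/--     item stmt-BirchSwinnertonDyer-19402 · support · rank 910 · open
    parent: PublishedInputsKolyThree · by operator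
    sources: Skinner2016PacificMC, GreenbergLNM1716
[support] Skinner 2016 Thm. A (§1, §2.3–2.4, §3.2–3.3; Greenberg LNM 1716 §2 Props. 2.1–2.4): the
cyclotomic main conjecture (equality of characteristic ideals) at a multiplicative prime p under the
image / ramification hypotheses as printed — conjunct of PublishedInputsThree
(stmt-BirchSwinnertonDyer-19112), BY NAME; same content, filed as a split child so the head constant
is item-stated (gate5 #15c one rule / readiness rule 2026-08-15: a cite_only dep must be declared by
the route); no crux statement / closes / tribunal / tribunal_fit change -/
@[route_item "route-BirchSwinnertonDyer-KolyvaginRoadThree"]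
def SkinnerMultiplicativeMainConjecture : Prop :=
  Literature.NumberTheory.EllipticCurves.Skinner2016.thmA_charIdeal_multiplicative

-- parent: PublishedInputsKolyThree · child (gen 1)
/--     item stmt-BirchSwinnertonDyer-19473 · support · rank 911 · open
    parent: PublishedInputsKolyThree · by planner
    sources: SteinWuthrich2013
[aside] Stein–Wuthrich 2013 Thm. 6.1, non-split multiplicative case (`thm61_nonsplitMultiplicative`)
— conjunct 17. Banked context (D-0019 aside): never staffed, not progress, BC6-exempt; filed ONLY so
the cite_only head constant inside the tail child PublishedInputsTail of the PublishedInputs split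
is item-stated BY NAME (gate5 #15c one rule, kind support OR aside counts; K3 README fallback shape;
director-bsd 05:15:22Z K5 staffable remedy); no crux statement / closes / tribunal / tribunal_fit
change intended. -/
@[route_item "route-BirchSwinnertonDyer-KolyvaginRoadThree"]
def SteinWuthrichNonsplitLeadingTerm : Prop :=
  Literature.NumberTheory.EllipticCurves.SteinWuthrich2013.thm61_nonsplitMultiplicative

-- parent: PublishedInputsKolyThree · child (gen 1)
/--     item stmt-BirchSwinnertonDyer-19475 · support · rank 912 · closed · proved by Summit.BirchSwinnertonDyer.BirchSwinnertonDyer.Theorems.steinWuthrichMultCanonicalExists_holds (prover)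
    parent: PublishedInputsKolyThree · by planner
    sources: SteinWuthrich2013, Werner1998
[aside] Stein–Wuthrich 2013 §4: existence of the canonical p-adic height datum, multiplicative case
(`exists_isMultCanonical`) — conjunct 19. Banked context (D-0019 aside): never staffed, not
progress, BC6-exempt; filed ONLY so the cite_only head constant inside the tail child
PublishedInputsTail of the PublishedInputs split is item-stated BY NAME (gate5 #15c one rule, kind
support OR aside counts; K3 README fallback shape; director-bsd 05:15:22Z K5 staffable remedy); no
crux statement / closes / tribunal / tribunal_fit change intended. -/
@[route_item "route-BirchSwinnertonDyer-KolyvaginRoadThree"]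
def SteinWuthrichMultCanonicalHeight : Prop :=
  Literature.NumberTheory.EllipticCurves.SteinWuthrich2013.exists_isMultCanonical

/-- `SteinWuthrichMultCanonicalHeight` holds: proved by `Summit.BirchSwinnertonDyer.BirchSwinnertonDyer.Theorems.steinWuthrichMultCanonicalExists_holds`. -/
theorem SteinWuthrichMultCanonicalHeight_holds : SteinWuthrichMultCanonicalHeight := _root_.Summit.BirchSwinnertonDyer.BirchSwinnertonDyer.Theorems.steinWuthrichMultCanonicalExists_holds

-- parent: PublishedInputsKolyThree · child (gen 1)
/--     item stmt-BirchSwinnertonDyer-19403 · support · rank 913 · open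
    parent: PublishedInputsKolyThree · by operator
    sources: Disegni2020, Disegni2017
[support] Disegni 2020 Thm. 1 (§1.2) = Thm. 4 (§3.2), (BSD_p) §1.1.4, Def. 1 §2.1, Prop. 2 §3.1
(arXiv:1609.02528): the p-adic BSD formula in analytic rank one at a multiplicative prime (regulator
conventions §1.1.3, §2.1; Disegni 2017 §1.3.1 height identification) — conjunct of
PublishedInputsThree (stmt-BirchSwinnertonDyer-19112), BY NAME; same content, filed as a split child
so the head constant is item-stated (gate5 #15c one rule / readiness rule 2026-08-15: a cite_only
dep must be declared by the route); no crux statement / closes / tribunal / tribunal_fit change -/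
@[route_item "route-BirchSwinnertonDyer-KolyvaginRoadThree"]
def DisegniPAdicBSDRankOneMultiplicative : Prop :=
  Literature.NumberTheory.EllipticCurves.Disegni2020.thm1_padicBSD_rankOne_multiplicative

-- parent: PublishedInputsKolyThree · child (gen 1)
/--     item stmt-BirchSwinnertonDyer-19266 · support · rank 914 · open
    parent: PublishedInputsKolyThree · by planner
    sources: BCDTJAMS2001
[support] modularity of E/ℚ as parametrisation data (Breuil–Conrad–Diamond–Taylor 2001 Thm A), BY
NAME — conjunct of OrdPublishedInputsAtTwo (19149; Literature.Uncategorized.OrdPublishedInputsAtTwo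
l.26); same content, filed so the head constant is item-stated (#15c one rule; cite_only dep) -/
@[route_item "route-BirchSwinnertonDyer-KolyvaginRoadThree"]
def ModularParametrizationSupply : Prop :=
  Literature.NumberTheory.EllipticCurves.ModularForms.nonempty_modularParametrizationData

-- parent: PublishedInputsKolyThree · child (gen 1)
/--     item stmt-BirchSwinnertonDyer-19404 · support · rank 915 · open
    parent: PublishedInputsKolyThree · by operator
    sources: Hsieh2014, Castella2018, Bump1997
[support] Hsieh 2014 Thm. A (Doc. Math. 19 p. 712 = arXiv:1112.1580 Thm. 1 pp. 3–4) and Thm. 5.6 (p.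
23): existence of the anticyclotomic Rankin–Selberg (BDP-type) p-adic L-function with its
interpolation display (Castella 2018 p. 9 ll. 41–47 twist; Bump 1997 (5.52)–(5.53)) — conjunct of
PublishedInputsThree (stmt-BirchSwinnertonDyer-19112), BY NAME; same content, filed as a split child
so the head constant is item-stated (gate5 #15c one rule / readiness rule 2026-08-15: a cite_only
dep must be declared by the route); no crux statement / closes / tribunal / tribunal_fit change -/
@[route_item "route-BirchSwinnertonDyer-KolyvaginRoadThree"]
def HsiehAnticyclotomicPAdicLFunction : Prop :=
  Literature.NumberTheory.EllipticCurves.hsieh2014_exists_anticyclotomicPAdicLFunction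

-- parent: PublishedInputsKolyThree · child (gen 1)
/--     item stmt-BirchSwinnertonDyer-19414 · support · rank 916 · open
    parent: PublishedInputsKolyThree · by operator
    sources: McCallumLMS1991, Kolyvagin1991MathAnn, GrossLMS1991
[support] McCallum 1991 (LMS LN 153) §5 Cor. 5.6 (p. 310), M_r and Lemma 5.1 (p. 303), Thm. 5.4 (p.
308), §4 S_r(M) (pp. 299–300); Kolyvagin 1991 Math. Ann. §1 B(E) p. 254; Gross 1991 §4 (4.1): the
Kolyvagin–McCallum structure bound p^{…} ∣ #Ш[p^∞] from a derived-class certificate — conjunct of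
PublishedInputsKolyThree (stmt-BirchSwinnertonDyer-19156), BY NAME; same content, filed as a split
child so the head constant is item-stated (gate5 #15c one rule / readiness rule 2026-08-15: a
cite_only dep must be declared by the route); no crux statement / closes / tribunal / tribunal_fit
change -/
@[route_item "route-BirchSwinnertonDyer-KolyvaginRoadThree"]
def McCallumShaStructureCertificate : Prop :=
  Literature.NumberTheory.EllipticCurves.McCallum1991_pow_dvd_card_sha_primary_of_certificate

-- parent: PublishedInputsKolyThree · child (gen 1)
/--     item stmt-BirchSwinnertonDyer-19415 · support · rank 917 · open
    parent: PublishedInputsKolyThree · by operator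
    sources: GrossZagier1986, Kolyvagin1990, MatarNekovar2019, MilneADT2006, GrossLMS1991, Darmon2004
[support] the Prop-valued FAMILIES among the conjuncts of PublishedInputsKolyThree
(stmt-BirchSwinnertonDyer-19156) grouped into one child (families are not deps-flagged; only closed
cite_only Props need a by-name item): gross_zagier ∧ kolyvagin ∧
Kolyvagin1990_padicValNat_card_sha_le ∧ poitouTate_sum_localTatePairing_eq_zero ∧
MatarNekovar2019.thm03_padicValNat_card_sha_le_of_irreducible ∧
heegnerPointOfConductor_one_galoisConj ∧ (Nonempty KolyvaginHeegnerData at conductor 1) —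
Gross–Zagier / Kolyvagin / Poitou–Tate / local Euler–Poincaré / Matar–Nekovář / Heegner conductor-1
data; same content as the parent conjuncts; with the by-name siblings the generated glue
PublishedInputsKolyThreeOfParts : C₁ → … → C_k → PublishedInputsKolyThree is the anonymous
constructor re-assembling the conjunction in its original order (farm-checked term in
AliasSketch-KolyvaginRoadThree.lean); no crux statement / closes / tribunal change -/
@[route_item "route-BirchSwinnertonDyer-KolyvaginRoadThree"]
def ClassicalInputsKolyThree : Prop :=
  (∀ (N : ℕ) [NeZero N] (W : WeierstrassCurve ℚ) (K : Type) [Field K] [NumberField K], Literature.NumberTheory.EllipticCurves.gross_zagier N W K) ∧ (∀ (N : ℕ) [NeZero N] (W : WeierstrassCurve ℚ) (K : Type) [Field K] [NumberField K], Literature.NumberTheory.EllipticCurves.kolyvagin N W K) ∧ (∀ (N : ℕ) [NeZero N] (W : WeierstrassCurve ℚ) (K : Type) [Field K] [NumberField K], Literature.NumberTheory.EllipticCurves.Kolyvagin1990_padicValNat_card_sha_le N W K) ∧ (∀ (K : Type) [Field K] [NumberField K], Literature.NumberTheory.GaloisCohomology.poitouTate_sum_localTatePairing_eq_zero K) ∧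 (∀ (N : ℕ) [NeZero N] (W : WeierstrassCurve ℚ) (K : Type) [Field K] [NumberField K], Literature.NumberTheory.EllipticCurves.MatarNekovar2019.thm03_padicValNat_card_sha_le_of_irreducible N W K) ∧ (∀ (N : ℕ) [NeZero N] (W : WeierstrassCurve ℚ) (K : Type) [Field K] [NumberField K], Literature.NumberTheory.EllipticCurves.heegnerPointOfConductor_one_galoisConj N W K) ∧ (∀ (W : WeierstrassCurve ℚ) [W.IsElliptic] [W.IsGloballyMinimal] [NeZero (W.conductorNorm ℤ)] (K : Type) [Field K] [NumberField K] (Dt : Literature.NumberTheory.EllipticCurves.ModularForms.ModularParametrizationData W (W.conductorNorm ℤ)) (β : ℤ) (ι : K →+* ℂ), Literature.NumberTheory.EllipticCurves.IsImaginaryQuadratic K → Literature.NumberTheory.EllipticCurves.SatisfiesHeegnerHypothesis (W.conductorNorm ℤ) K → (4 * (W.conductorNorm ℤ : ℤ)) ∣ β ^ 2 - NumberField.discr K → Nonempty (Literature.NumberTheory.EllipticCurves.KolyvaginHeegnerData Dt β ι 1))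

-- parent: PublishedInputsKolyThree · glue (gen 1)
/--     item stmt-BirchSwinnertonDyer-19416 · support · rank 918 · closed · proved by Summit.BirchSwinnertonDyer.BirchSwinnertonDyer.Theorems.kolyvaginRoadThree_publishedInputsKolyThreeOfParts_holds (prover)
    parent: PublishedInputsKolyThree · GLUE: children ⟹ parent · by operator
children = the sixteen cite_only conjuncts of PublishedInputsKolyThree BY NAME + one rest child
ClassicalInputsKolyThree (families gross_zagier / kolyvagin / Kolyvagin1990 / poitouTate /
MatarNekovar2019 / heegnerPointOfConductor_one_galoisConj / KolyvaginHeegnerData at conductor 1);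
glue PublishedInputsKolyThreeOfParts : C1 → … → C17 → PublishedInputsKolyThree re-nests ⟨⟨20⟩,
McCallum, rec, KD⟩ (AliasSketch-KolyvaginRoadThree.lean publishedInputsKolyThreeOfParts_holds, farm
rc 0) -/
@[route_item "route-BirchSwinnertonDyer-KolyvaginRoadThree"]
def PublishedInputsKolyThreeOfParts : Prop :=
  SkinnerRankZeroPPart → WuthrichShaDividesAnalyticSha → RankEqAnalyticRankLeOne → EntireLFunctionRat → NewformOfEllipticCurve → HoffsteinLuoNonvanishingTwist → MazurManinConstantOddPrimes → FriedbergHoffsteinTwistInertAt → BarriosEtAlTamagawaTwistAtTwo → SkinnerMultiplicativeMainConjecture → SteinWuthrichNonsplitLeadingTerm → SteinWuthrichMultCanonicalHeight → DisegniPAdicBSDRankOneMultiplicative → ModularParametrizationSupply → HsiehAnticyclotomicPAdicLFunction → McCallumShaStructureCertificate → ClassicalInputsKolyThree → PublishedInputsKolyThree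

-- `PublishedInputsKolyThreeOfParts` holds: proved by `Summit.BirchSwinnertonDyer.BirchSwinnertonDyer.Theorems.kolyvaginRoadThree_publishedInputsKolyThreeOfParts_holds` (its module imports this route file, so no `_holds` link can be stated here).

/-- item stmt-BirchSwinnertonDyer-19405 · aside · rank 9 · open · by planner
sources: CastellaHsieh2018, deShalit1987
[aside] the cell-posited @[conjecture] predicate `Three.HsiehDescentAt₃ W`
(X11b/Three/HsiehDescent.lean: H1@3, Castella–Hsieh 2018 Def. 3.5 / Prop. 3.6 shape at 3 ∥ N; de
Shalit II.4.11) for every X11b@3 class — the first conjunct of crux HsiehDescentAtThree (19108)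
stated alone — filed as a by-name ASIDE (banked context: never staffed, not progress, BC6-exempt) so
the @[conjecture] leaf is item-stated under the #15c rule (head of the conclusion under ∀/→); K3
precedent (KobayashiConjecture asides, bsd-ssimc E1 03:37Z); no crux statement / closes / tribunal /
tribunal_fit change -/
@[route_item "route-BirchSwinnertonDyer-KolyvaginRoadThree"]
def HsiehDescentLeafAtThree : Prop :=
  ∀ (W : WeierstrassCurve ℚ) [W.IsElliptic] [W.IsGloballyMinimal], Summit.BirchSwinnertonDyer.Rank1Residual.ClassX11b W 3 → Summit.BirchSwinnertonDyer.Rank1Residual.X11b.Three.HsiehDescentAt₃ W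

/-- item stmt-BirchSwinnertonDyer-19406 · aside · rank 9 · open · by planner
sources: Castella2018
[aside] the cell-posited @[conjecture] predicate `Three.BDPValueAt₃ W` (X11b/Three/StepLHalves.lean:
H2@3, Castella 2018 Thm. 3.2 shape at 3 ∥ N, nothing asserted) for every X11b@3 class — the H2
conjuncts of crux HalvesAtThree (19107) / HalvesTamAtThree (19155) are its restrictions — filed as a
by-name ASIDE (banked context: never staffed, not progress, BC6-exempt) so the @[conjecture] leaf is
item-stated under the #15c rule (head of the conclusion under ∀/→); K3 precedent
(KobayashiConjecture asides, bsd-ssimc E1 03:37Z); no crux statement / closes / tribunal /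
tribunal_fit change -/
@[route_item "route-BirchSwinnertonDyer-KolyvaginRoadThree"]
def BDPValueLeafAtThree : Prop :=
  ∀ (W : WeierstrassCurve ℚ) [W.IsElliptic] [W.IsGloballyMinimal], Summit.BirchSwinnertonDyer.Rank1Residual.ClassX11b W 3 → Summit.BirchSwinnertonDyer.Rank1Residual.X11b.Three.BDPValueAt₃ W

/-- item stmt-BirchSwinnertonDyer-19407 · aside · rank 9 · open · by planner
sources: Castella2018, Castella2018Erratum
[aside] the cell-posited @[conjecture] predicate `Three.IMCDivAt₃ W` (StepLHalves.lean: H3@3,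
Castella 2018 (1.b) / Thm. 4.4 and erratum Thm. 1.1 shape at 3 ∥ N, nothing asserted) for every
X11b@3 class — the H3 conjuncts of cruxes 19107 / 19155 are its restrictions — filed as a by-name
ASIDE (banked context: never staffed, not progress, BC6-exempt) so the @[conjecture] leaf is
item-stated under the #15c rule (head of the conclusion under ∀/→); K3 precedent
(KobayashiConjecture asides, bsd-ssimc E1 03:37Z); no crux statement / closes / tribunal /
tribunal_fit change -/
@[route_item "route-BirchSwinnertonDyer-KolyvaginRoadThree"]
def IMCDivLeafAtThree : Prop :=
  ∀ (W : WeierstrassCurve ℚ) [W.IsElliptic] [W.IsGloballyMinimal], Summit.BirchSwinnertonDyer.Rank1Residual.ClassX11b W 3 → Summit.BirchSwinnertonDyer.Rank1Residual.X11b.Three.IMCDivAt₃ W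

/-- item stmt-BirchSwinnertonDyer-19408 · aside · rank 9 · open · by planner
sources: Castella2018
[aside] the cell-posited @[conjecture] predicate `Three.CornerStepLAt W` (CornerResidual.lean: STEP
L on the ¬Surj corner at 3, Castella 2018 Thm. 3.2 shape read without Surj; its hypotheses ClassX11b
W 3 → ¬ Surj W 3 → … are inside the predicate) for every minimal W — the first conjunct of crux
CornerAtThree (19111) stated alone — filed as a by-name ASIDE (banked context: never staffed, not
progress, BC6-exempt) so the @[conjecture] leaf is item-stated under the #15c rule (head of the
conclusion under ∀/→); K3 precedent (KobayashiConjecture asides, bsd-ssimc E1 03:37Z); no crux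
statement / closes / tribunal / tribunal_fit change -/
@[route_item "route-BirchSwinnertonDyer-KolyvaginRoadThree", crux]
def CornerStepLLeafAtThree : Prop :=
  ∀ (W : WeierstrassCurve ℚ) [W.IsElliptic] [W.IsGloballyMinimal], Summit.BirchSwinnertonDyer.Rank1Residual.X11b.Three.CornerStepLAt W

/-- item stmt-BirchSwinnertonDyer-19409 · aside · rank 9 · open · by planner
sources: Miller2011LMS, Skinner2016PacificMC
[aside] the cell-posited @[conjecture] predicate `Three.CornerTwistAt W` (CornerResidual.lean: BSD₃
of the rank-0 twist on the ¬Surj corner; Miller 2011 Def. 1.1 shape, Skinner Thm. C display void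
there) — the second conjunct of crux CornerAtThree (19111) stated alone — filed as a by-name ASIDE
(banked context: never staffed, not progress, BC6-exempt) so the @[conjecture] leaf is item-stated
under the #15c rule (head of the conclusion under ∀/→); K3 precedent (KobayashiConjecture asides,
bsd-ssimc E1 03:37Z); no crux statement / closes / tribunal / tribunal_fit change -/
@[route_item "route-BirchSwinnertonDyer-KolyvaginRoadThree"]
def CornerTwistLeafAtThree : Prop :=
  ∀ (W : WeierstrassCurve ℚ) [W.IsElliptic] [W.IsGloballyMinimal], Summit.BirchSwinnertonDyer.Rank1Residual.X11b.Three.CornerTwistAt W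

/-- item stmt-BirchSwinnertonDyer-19410 · aside · rank 9 · open · by planner
sources: Jetchev2008, GrossLMS1991
[aside] the cell-posited @[conjecture] predicate `Three.CornerUpperAt W` (CornerResidual.lean: the
Euler-system upper bound on the ¬Surj ∧ 3 ∣ ∏c corner; Jetchev 2008 Thm. 1.1 / Gross 1991 Conj.
(2.2) shapes, hypotheses not met in print) — the third conjunct of crux CornerAtThree (19111) stated
alone — filed as a by-name ASIDE (banked context: never staffed, not progress, BC6-exempt) so the
@[conjecture] leaf is item-stated under the #15c rule (head of the conclusion under ∀/→); K3
precedent (KobayashiConjecture asides, bsd-ssimc E1 03:37Z); no crux statement / closes / tribunal /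
tribunal_fit change -/
@[route_item "route-BirchSwinnertonDyer-KolyvaginRoadThree"]
def CornerUpperLeafAtThree : Prop :=
  ∀ (W : WeierstrassCurve ℚ) [W.IsElliptic] [W.IsGloballyMinimal], Summit.BirchSwinnertonDyer.Rank1Residual.X11b.Three.CornerUpperAt W

/-- item stmt-BirchSwinnertonDyer-19472 · aside · rank 9 · open · by planner
[aside] Stein–Wuthrich 2013 (Math. Comp. 82) Thm. 6.1, split multiplicative case: leading term of
the characteristic series with the extra zero (`thm61_splitMultiplicative`) — conjunct 16. Banked
context (D-0019 aside): never staffed, not progress, BC6-exempt; filed ONLY so the cite_only head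
constant inside the tail child PublishedInputsTail of the PublishedInputs split is item-stated BY
NAME (gate5 #15c one rule, kind support OR aside counts; K3 README fallback shape; director-bsd
05:15:22Z K5 staffable remedy); no crux statement / closes / tribunal / tribunal_fit change
intended. -/
@[route_item "route-BirchSwinnertonDyer-KolyvaginRoadThree"]
def SteinWuthrichSplitLeadingTerm : Prop :=
  Literature.NumberTheory.EllipticCurves.SteinWuthrich2013.thm61_splitMultiplicative

/-- item stmt-BirchSwinnertonDyer-19615 · aside · rank 9 · open · by planner
why it might fail: printed; only a transcription slip could fail (referee C round 293 checked the typing 12/12 EXACT)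
sources: CaiShuTian2014, PastenShimura2024, JetchevSkinnerWan2017, Nekovar2007
[support · PRINTED, HELD] conjuncts 1–3 of the Literature fact
`shimuraCurve_heegnerPoint_grossZagier_kolyvagin` (item 19526): existence of the Shimura–Heegner
point on X_{N⁺,N⁻} with the explicit Gross–Zagier display and the degree-valuation link —
Cai–Shu–Tian 2014 Thm 1.5 + special case 1, Pasten 2024 Prop 5.1, JSW17 §4.3/Rem 17, Nekovář 2007
Thm 3.2. Text = D-AUDIT-19526c4 §III sketch (lit g9, 17eee2fa) verbatim, fully qualified; implied by
19526 (`printed_of_fact`, planner Sketch-DOWN.lean rc 0). Never a prover target. -/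
@[route_item "route-BirchSwinnertonDyer-KolyvaginRoadThree"]
def ShimuraHeegnerPointGrossZagierPrinted : Prop :=
  ∀ (W : WeierstrassCurve ℚ) [W.IsElliptic] [W.IsGloballyMinimal] (p : ℕ) [Fact p.Prime] (N : ℕ) [NeZero N] (K : Type) [Field K] [NumberField K] (S : Finset ℕ) (Dt : Literature.NumberTheory.EllipticCurves.ModularForms.ModularParametrizationData W N) (X : Literature.NumberTheory.Automorphic.ShimuraCurveData (∏ q ∈ S, q) (N / ∏ q ∈ S, q)) (W' : WeierstrassCurve ℚ) [W'.IsElliptic] (P₀ : Literature.NumberTheory.Automorphic.ShimuraParametrizationData X W'), W.conductorNorm ℤ = N → p ≠ 2 → W.HasIrreducibleModPGaloisRep p → Literature.NumberTheory.EllipticCurves.IsImaginaryQuadratic K → Even S.card → (∀ ℓ ∈ S, ℓ.Prime ∧ ℓ ∣ N ∧ ¬ ℓ ^ 2 ∣ N ∧ ((Ideal.span {(ℓ : ℤ)}).primesOver (NumberField.RingOfIntegers K)).ncard = 1 ∧ ¬ (ℓ : ℤ) ∣ NumberField.discr K) → (∀ ℓ : ℕ, ℓ.Prime → ℓ ∣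 N → ℓ ∉ S → ((Ideal.span {(ℓ : ℤ)}).primesOver (NumberField.RingOfIntegers K)).ncard = 2) → ((Ideal.span {(p : ℤ)}).primesOver (NumberField.RingOfIntegers K)).ncard = 2 → P₀.IsMinimalFor W → ∃ (P : (W.baseChange K).toAffine.Point) (degS : ℕ), 0 < degS ∧ padicValNat p degS = padicValNat p P₀.deg ∧ Literature.NumberTheory.EllipticCurves.LDerivEK W K = 8 * (Real.pi : ℂ) ^ 2 * Literature.NumberTheory.EllipticCurves.ModularForms.peterssonProduct (CongruenceSubgroup.Gamma0 N) 2 Dt.f Dt.f / ((((NumberField.Units.torsionOrder K : ℝ) / 2) ^ 2 * √|(NumberField.discr K : ℝ)| : ℝ) : ℂ) * ((P.canonicalHeight : ℂ) / (degS : ℂ))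

/-- item stmt-BirchSwinnertonDyer-19617 · support · rank 9 · open · by planner
why it might fail: as 19526 (claim-tagged named fact used as hypothesis)
sources: JetchevSkinnerWan2017, CaiShuTian2014, Nekovar2007
[support · HELD] the Literature fact `shimuraCurve_heegnerPoint_grossZagier_kolyvagin` (item 19526)
OFF the locus (¬(p = 3 ∧ p ∣ N)) — literally 19526 restricted, implied by it verbatim
(`offThree_of_fact`, Sketch-DOWN.lean rc 0); keeps 19526's `[claim … under-review]` standing
(D-AUDIT scope note (iii)); not used at this route's pairs (p = 3 ∥ N always) but needed to rebuild
the ∀-quantified fact the kernel consumer takes. Never a prover target. -/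
@[route_item "route-BirchSwinnertonDyer-KolyvaginRoadThree", crux]
def ShimuraCurveFactOffLocusThree : Prop :=
  ∀ (W : WeierstrassCurve ℚ) [W.IsElliptic] [W.IsGloballyMinimal] (p : ℕ) [Fact p.Prime] (N : ℕ) [NeZero N] (K : Type) [Field K] [NumberField K] (S : Finset ℕ) (Dt : Literature.NumberTheory.EllipticCurves.ModularForms.ModularParametrizationData W N) (X : Literature.NumberTheory.Automorphic.ShimuraCurveData (∏ q ∈ S, q) (N / ∏ q ∈ S, q)) (W' : WeierstrassCurve ℚ) [W'.IsElliptic] (P₀ : Literature.NumberTheory.Automorphic.ShimuraParametrizationData X W'), W.conductorNorm ℤ = N → p ≠ 2 → W.HasIrreducibleModPGaloisRep p → Literature.NumberTheory.EllipticCurves.IsImaginaryQuadratic K → Even S.card → (∀ ℓ ∈ S, ℓ.Prime ∧ ℓ ∣ N ∧ ¬ ℓ ^ 2 ∣ N ∧ ((Ideal.span {(ℓ : ℤ)}).primesOver (NumberField.RingOfIntegers K)).ncard = 1 ∧ ¬ (ℓ : ℤ) ∣ NumberField.discr K) → (∀ ℓ : ℕ, ℓ.Prime → ℓ ∣ N →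 ℓ ∉ S → ((Ideal.span {(ℓ : ℤ)}).primesOver (NumberField.RingOfIntegers K)).ncard = 2) → ((Ideal.span {(p : ℤ)}).primesOver (NumberField.RingOfIntegers K)).ncard = 2 → P₀.IsMinimalFor W → ¬ (p = 3 ∧ p ∣ N) → ∃ (P : (W.baseChange K).toAffine.Point) (degS : ℕ), 0 < degS ∧ padicValNat p degS = padicValNat p P₀.deg ∧ Literature.NumberTheory.EllipticCurves.LDerivEK W K = 8 * (Real.pi : ℂ) ^ 2 * Literature.NumberTheory.EllipticCurves.ModularForms.peterssonProduct (CongruenceSubgroup.Gamma0 N) 2 Dt.f Dt.f / ((((NumberField.Units.torsionOrder K : ℝ) / 2) ^ 2 * √|(NumberField.discr K : ℝ)| : ℝ) : ℂ) * ((P.canonicalHeight : ℂ) / (degS : ℂ)) ∧ (¬ IsOfFinAddOrder P → Nat.card (AddCommGroup.primaryComponent (W.baseChange K).sha p) ≤ p ^ (2 * padicValNat p (AddSubgroup.zmultiples P).index))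

/-- item stmt-BirchSwinnertonDyer-19716 · aside · rank 9 · open · by planner
[support · published input, by-name alias, HELD] Pasten 2024 §6.4 ∕ §6.6 ∕ Prop. 6.13 ∕ Lemma 6.14
(proof) ∕ Lemma 6.18: component-group orders of Shimura-curve parametrisations incl. the
Papikian–Rabinoff cokernel clause — named Literature fact `PastenShimura2024_componentOrders` (typer
shim-t1 p419282, reviewed). Supplies the degree identity (DEG) of the inert re-key
(`padicValNat_delta_empty_eq_of_oddPairing`). -/
@[route_item "route-BirchSwinnertonDyer-KolyvaginRoadThree", crux]
def PastenComponentOrdersInput : Prop :=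
  Literature.NumberTheory.Automorphic.PastenShimura2024_componentOrders

/-- item stmt-BirchSwinnertonDyer-19935 · aside · rank 9 · open · by planner
[aside] Kato 2004 Thm 12.4 (2)(3) (p. 221): 𝐇² is Λ-torsion-free-rank bookkeeping / 𝐇¹ free of rank
1 (`Kato2004.thm12_4`) — conjunct 18 of KatoTwinFactsFiveAn Banked context (D-0019 aside): never
staffed, not progress, BC6-exempt; filed ONLY so the cite_only head constant inside the depth-1
support child KatoTwinFactsFiveAn of the NonSurjCorner split is item-stated BY NAME (gate5 #15c;
precedent asides 19369–19375, planner g24 E1); no crux statement / closes / tribunal / tribunal_fit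
change. -/
@[route_item "route-BirchSwinnertonDyer-KolyvaginRoadThree"]
def KatoFinitelyGeneratedIwasawaH2 : Prop :=
  Literature.NumberTheory.EllipticCurves.Kato2004.thm12_4

/-- item stmt-BirchSwinnertonDyer-19936 · aside · rank 9 · open · by planner
[aside] Kato 2004 §17.13 package at a NON-SPLIT multiplicative odd prime (12.5 (1)–(3), 12.6, 16.6
(2)/§16.1, (17.13.1)–(17.13.3) with Rubin 1998 Prop A.2 / Wuthrich 2014 p. 391): CONSTRUCTION fact
`Kato2004.exists_multDivisibilityInputs_nonsplit` (bsd-2adic-mult GEN 9, p474627) — conjunct 19 of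
KatoTwinFactsFiveAn Banked context (D-0019 aside): never staffed, not progress, BC6-exempt; filed
ONLY so the cite_only head constant inside the depth-1 support child KatoTwinFactsFiveAn of the
NonSurjCorner split is item-stated BY NAME (gate5 #15c; precedent asides 19369–19375, planner g24
E1); no crux statement / closes / tribunal / tribunal_fit change. -/
@[route_item "route-BirchSwinnertonDyer-KolyvaginRoadThree"]
def KatoMultDivisibilityInputsNonsplit : Prop :=
  Literature.NumberTheory.EllipticCurves.Kato2004.exists_multDivisibilityInputs_nonsplit

/-- item stmt-BirchSwinnertonDyer-19937 · aside · rank 9 · open · by planner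
[aside] Kato 2004 §17.13 package at a SPLIT multiplicative odd prime (exceptional-zero form,
Kobayashi 2006 Thm 4.1): CONSTRUCTION fact `Kato2004.exists_multDivisibilityInputs_split` (p474627)
— conjunct 20 of KatoTwinFactsFiveAn Banked context (D-0019 aside): never staffed, not progress,
BC6-exempt; filed ONLY so the cite_only head constant inside the depth-1 support child
KatoTwinFactsFiveAn of the NonSurjCorner split is item-stated BY NAME (gate5 #15c; precedent asides
19369–19375, planner g24 E1); no crux statement / closes / tribunal / tribunal_fit change. -/
@[route_item "route-BirchSwinnertonDyer-KolyvaginRoadThree"]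
def KatoMultDivisibilityInputsSplit : Prop :=
  Literature.NumberTheory.EllipticCurves.Kato2004.exists_multDivisibilityInputs_split

/-- item stmt-BirchSwinnertonDyer-19938 · aside · rank 9 · open · by planner
[aside] Kato 2004 §17.13 package at p ∥ N WITH the fine quotient (14.9.3), the Thm 12.6 span clause
and the p. 280 image clause in the Néron normalisation: CONSTRUCTION fact
`Kato2004.exists_multDivisibilityInputs_fine` (corner-p1 g6, p487500) — conjunct 23 of
KatoTwinFactsFiveAn, the F1 of the twin's μ-transfer (K6-parallel); flags
Kato-17.11-at-{nonsplit,split}-mult, Kato-p280-image-at-mult Banked context (D-0019 aside): never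
staffed, not progress, BC6-exempt; filed ONLY so the cite_only head constant inside the depth-1
support child KatoTwinFactsFiveAn of the NonSurjCorner split is item-stated BY NAME (gate5 #15c;
precedent asides 19369–19375, planner g24 E1); no crux statement / closes / tribunal / tribunal_fit
change. -/
@[route_item "route-BirchSwinnertonDyer-KolyvaginRoadThree"]
def KatoMultDivisibilityInputsFine : Prop :=
  Literature.NumberTheory.EllipticCurves.Kato2004.exists_multDivisibilityInputs_fine

/-- item stmt-BirchSwinnertonDyer-19939 · aside · rank 9 · open · by planner
[aside] Greenberg 1999 (LNM 1716) Thm 1.5 at a multiplicative prime, rational form: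
Sel_{p^∞}(E/ℚ_∞)^∨ is Λ-torsion when L(E,1) ≠ 0 (`Greenberg1999.thm15_isTorsion_multiplicative_rat`)
— conjunct 21 of KatoTwinFactsFiveAn Banked context (D-0019 aside): never staffed, not progress,
BC6-exempt; filed ONLY so the cite_only head constant inside the depth-1 support child
KatoTwinFactsFiveAn of the NonSurjCorner split is item-stated BY NAME (gate5 #15c; precedent asides
19369–19375, planner g24 E1); no crux statement / closes / tribunal / tribunal_fit change. -/
@[route_item "route-BirchSwinnertonDyer-KolyvaginRoadThree"]
def GreenbergSelmerCotorsionMultiplicative : Prop :=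
  Literature.NumberTheory.EllipticCurves.Greenberg1999.thm15_isTorsion_multiplicative_rat

/-- item stmt-BirchSwinnertonDyer-19940 · aside · rank 9 · open · by planner
[aside] Wuthrich 2014 Cor 18 (p. 398) with §3.2: the Néron-normalised Mazur–Tate–Teitelbaum p-adic
L-function lies in Λ at an odd multiplicative prime
(`Wuthrich2014.corollary18_padicLFunction_mem_iwasawaAlgebra_multiplicative`) — conjunct 22 of
KatoTwinFactsFiveAn Banked context (D-0019 aside): never staffed, not progress, BC6-exempt; filed
ONLY so the cite_only head constant inside the depth-1 support child KatoTwinFactsFiveAn of the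
NonSurjCorner split is item-stated BY NAME (gate5 #15c; precedent asides 19369–19375, planner g24
E1); no crux statement / closes / tribunal / tribunal_fit change. -/
@[route_item "route-BirchSwinnertonDyer-KolyvaginRoadThree"]
def WuthrichIntegralPAdicLFunctionMultiplicative : Prop :=
  Literature.NumberTheory.EllipticCurves.Wuthrich2014.corollary18_padicLFunction_mem_iwasawaAlgebra_multiplicative

/-- item stmt-BirchSwinnertonDyer-20191 · support · rank 9 · closed · proved by Summit.BirchSwinnertonDyer.BirchSwinnertonDyer.Theorems.ShaTwoCochainTheta.ErratumRoadFive.ShimuraCasselsTateLevelInputs_proof (prover) · by planner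
sources: MilneADT2006, Harari2020, NeukirchSchmidtWingberg2008, Cassels1962ArithmeticIV, Tate1963DualityICM, McCallumLMS1991
[support · HELD printed input BY LITERATURE DECL NAME] the levelwise Cassels–Tate inputs for every
number field K: `Literature.NumberTheory.EllipticCurves.casselsTate_levelInputs K` (shim3a g3
p498917; local class field theory invariants + Albert–Brauer–Hasse–Noether + Poitou–Tate H³ + Milne
ADT I §6 cochain recipe + functoriality; discharging it = size XL, no `_holds` attempted). SHARED by
statement across K2 route-BirchSwinnertonDyer-ErratumRoadFive and the @3 routes -ClassRecordThree ∕
-KolyvaginRoadThree: consumed by each `closes` to derive the Shimura Kolyvagin order-bound crux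
inline (19718 via K7 p499140; 19899 via p502131 H-form + `…SurjTransport`). Cites: Milne ADT I §6;
Harari 2020 Prop 8.13/Thm 10.9/Thm 14.11; NSW (8.1.17); Cassels 1962 IV; Tate 1963 ICM; McCallum LMS
1991 §5 Thm 5.4/5.8; Gross LMS 1991 §5 (5.1). -/
@[route_item "route-BirchSwinnertonDyer-KolyvaginRoadThree", crux]
def ShimuraCasselsTateLevelInputs : Prop :=
  ∀ (K : Type) [Field K] [NumberField K], Literature.NumberTheory.EllipticCurves.casselsTate_levelInputs K

-- `ShimuraCasselsTateLevelInputs` holds: proved by `Summit.BirchSwinnertonDyer.BirchSwinnertonDyer.Theorems.ShaTwoCochainTheta.ErratumRoadFive.ShimuraCasselsTateLevelInputs_proof` (its module imports this route file, so no `_holds` link can be stated here).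

/-- item stmt-BirchSwinnertonDyer-20201 · aside · rank 9 · open · by planner
sources: CaiShuTian2014, Nekovar2007, GrossLMS1991, BertoliniDarmon1996, KolyvaginLogachev1990, PastenShimura2024
[support · HELD printed PRIMITIVES BY DECL NAME, reduced p = 3 form π₃ᴿ; referee
VERDICT-19899-PRICING-g40 PASS + VERDICT-PRIMITIVES-REDUCED-g42 PASS — no GAP, no SMUGGLED]
`Literature.NumberTheory.EllipticCurves.shimuraCurve_heegnerSystem_primitivesAtThree` (Literature
file `ShimuraCurveHeegnerSystemPrimitivesAtThree.lean`, shim-p2 g6, landed 06:49Z; body = the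
reduced text π₃ᴿ of HOME/shim/shim-p2-g5/PRIMITIVES-ASIDE-19899-reduced.lean = binder hPrimR of
p502131 — defeq verified on the farm: the def is accepted AS that binder in the certificate Sketch,
rc 0): on the p = 3 SPLIT Shimura-curve locus of class X11b (3 ∣ N, 3 split in K imaginary quadratic
with the S-inert/N-split Heegner hypothesis, #S even, ρ̄_{E,3} surjective (Surj W 3), p ≠ 2
irreducible, P₀ class-minimal) there exist ι : K → ℂ, a ring-class-tower family y m ∈ E(K[m]), yK ∈
E(K), ε = ±1, degy > 0 with v_3(degy) = v_3(deg P₀) and (B1, display) L′(E/K,1) =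
8π²(f,f)/((w_K/2)²√|d_K|)·ĥ(yK)/degy [CST14 Thm 1.5 sc 1]; (B2) bottom trace yK = Tr_{K[1]/K} y 1
[Gross 1991 (4.1); BD96 §2.5]; (B3) complex conjugation at every level m ≠ 0 [Gross Prop 5.3; BD96
Prop 2.6]; (B4) Hecke trace [Gross Prop 3.7(1); Nekovář 2007 (4.8)] -/
@[route_item "route-BirchSwinnertonDyer-KolyvaginRoadThree"]
def ShimuraHeegnerEulerSystemSplitAtThreePrinted : Prop :=
  Literature.NumberTheory.EllipticCurves.shimuraCurve_heegnerSystem_primitivesAtThree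

/-- item stmt-BirchSwinnertonDyer-20204 · aside · rank 9 · open · by planner
sources: Castella2018, Castella2018Erratum, Wan2020, arXiv:2107.13726
[aside] (H3 at 3, leaf form, RE-ORIENTED) for every E of class X11b at 3, the BDP-side
anticyclotomic IMC divisibility `Three.IMCDivAt₃B W`: for every frame (ι′, 𝔭) and the OTHER prime
𝔭bar ∣ 3, Ch_Λ(X_ac(E/K_∞))_{𝔭bar} · Λ^ur ⊆ (L_𝔭). B-twin of aside 19407 `IMCDivLeafAtThree` (family
A, misoriented — ERRATUM record). Banked context (D-0019 aside): never staffed, BC6-exempt; filed so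
the `@[conjecture]` head `Three.IMCDivAt₃B` is item-stated by name (#15c; K3 precedent
KobayashiConjecture asides). -/
@[route_item "route-BirchSwinnertonDyer-KolyvaginRoadThree"]
def IMCDivLeafAtThreeB : Prop :=
  ∀ (W : WeierstrassCurve ℚ) [W.IsElliptic] [W.IsGloballyMinimal], Summit.BirchSwinnertonDyer.Rank1Residual.ClassX11b W 3 → Summit.BirchSwinnertonDyer.Rank1Residual.X11b.Three.IMCDivAt₃B W

/-- item stmt-BirchSwinnertonDyer-20448 · support · rank 9 · open · by planner
sources: LiuZhangZhang2018
[support · PUB refereed, BY LITERATURE DECL NAME] Liu–Zhang–Zhang, Duke Math. J. 167 (2018) Thm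
1.5.1 + Rem 1.1.2 ∧ Thm 1.5.3: the p-adic Waldspurger formula for X₀(N) → E with the Heegner test
vector at the trivial character, at ANY prime p ∣ N, p² ∤ N, p split in K (typed p509230
`Literature/NumberTheory/EllipticCurves/LiuZhangZhang2018/PAdicWaldspurgerEllipticCurve.lean`,
bsd-littype-08; readings audited pub/bsd-eis LIT-DOSSIER §82/§86). Through
`X2.lzzRoadInputIoo_of_thm151_thm153` → `X2.exists_continuousDisplay_of_lzzRoadInputIoo` (bsd-eis
cgshw g13–g15) → thmc-p1 g8's `LZZKernel.bdpValueAt₃_of_lzzRoadInputIoo` (p526437) →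
`Three.BDPValueAt₃` it gives the BDP-value half of `HalvesAtThreeR` for EVERY X11b@3 curve (no
reducibility / image / rank hypothesis); consumed inside `closes`. Discharging it = typing LZZ's
proof (XL). -/
@[route_item "route-BirchSwinnertonDyer-KolyvaginRoadThree", crux]
def LZZWaldspurgerHeegner : Prop :=
  Literature.NumberTheory.EllipticCurves.LiuZhangZhang2018.thm151_thm153_modularCurve_heegnerVector

/-- item stmt-BirchSwinnertonDyer-20473 · support · rank 9 · open · by planner
sources: CaiShuTian2014, Nekovar2007, GrossLMS1991, BertoliniDarmon1996, JetchevSkinnerWan2017, PastenShimura2024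
[support · HELD printed PRIMITIVES BY LITERATURE DECL NAME, split-generic reduced form π₃ˢᴿ; referee
VERDICT-19899-PRICING-g40 PASS + VERDICT-PRIMITIVES-REDUCED-g42 PASS +
VERDICT-DELTA-PI3SR-FROMFIVE-g43 (E) PASS «referee-neutral-or-better, effective now»]
`Literature.NumberTheory.EllipticCurves.shimuraCurve_heegnerSystem_primitivesSplitReduced`
(Literature file `ShimuraCurveHeegnerSystemPrimitivesSplit.lean`, shim3a g4 p507652; body = the p =
3 text π₃ᴿ of `shimuraCurve_heegnerSystem_primitivesAtThree` VERBATIM with EXACTLY the three locus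
guards `Surj W 3 →`, `p ∣ N →`, `p = 3 →` deleted; binders = those of the display support 19615
`ShimuraHeegnerPointGrossZagierPrinted`): for E = W/ℚ minimal of conductor N, an odd prime p with
E[p] irreducible, K imaginary quadratic with the Jetchev–Skinner–Wan hypothesis (H) for the even
inert set S, p SPLIT in K, P₀ class-minimal on X_{N⁺,N⁻}, there exist ι : K → ℂ, a ring-class-tower
family y m ∈ E(K[m]), yK ∈ E(K), ε = ±1, degy > 0 with v_p(degy) = v_p(deg P₀) and (B1, display)
L′(E/K,1) = 8π²(f,f)/((w_K/2)²√|d_K|)·ĥ(yK)/degy [CST14 Thm 1.5 sc 1; JSW17 Rem. 17–18; Pasten 2024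
Prop 5.1]; (B2) bottom trace yK = Tr_{K[1]/K} y 1 [Gross 1991 (4 -/
@[route_item "route-BirchSwinnertonDyer-KolyvaginRoadThree", crux]
def ShimuraHeegnerEulerSystemSplitPrinted : Prop :=
  Literature.NumberTheory.EllipticCurves.shimuraCurve_heegnerSystem_primitivesSplitReduced

/-- item stmt-BirchSwinnertonDyer-20528 · support · rank 9 · open · by planner
sources: BertoliniDarmonPrasanna2013, Shimura1975, HidaTilouine1993
[support · PUB refereed, BY LITERATURE DECL NAME] Bertolini–Darmon–Prasanna, Duke Math. J. 162
(2013) Thm 5.4 (5.1.12)/(5.1.16) with Prop 1.12(1) (Shimura): the explicit Waldspurger formula for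
L(f/K,χ,1) in SQUARE-ROOT SHAPE — `bdpLalg f … φ n = (Σ_𝔞 (φ(𝔞)N𝔞^n)⁻¹·V_𝔞)²` with the CM values V_𝔞
in F = H(i), χ-free (typed p528626
`Literature/NumberTheory/EllipticCurves/BertoliniDarmonPrasanna2013/WaldspurgerCMSquareFormula.lean`,
referee g49 glyph-level PASS; atoms p533067 `thm54_bdpLalg_eq_sq_sum_heegnerPoints` +
`prop112_shimura_maassShimuraIter_heegnerTau_mem` with kernel `thm54_…_of_atoms` = its trust base).
Consumed by `closes` through the Theses-free kernel (Aut(ℂ/H(i))-reciprocity of the central values ⟹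
`ValueReciprocityBAtThree` ⟹ with Tate–Sen (19238) the Hsieh-descent residual 19108 on both loci).
Single Literature constant ⇒ item-stated (cone-debt rule satisfied). -/
@[route_item "route-BirchSwinnertonDyer-KolyvaginRoadThree", crux]
def BDPWaldspurgerSquare : Prop :=
  Literature.NumberTheory.EllipticCurves.BertoliniDarmonPrasanna2013.thm54_bdpLalg_eq_sq_sum_cmValues

/-- item stmt-BirchSwinnertonDyer-21421 · aside · rank 9 · open · by planner
sources: Miller2011LMS, HoffsteinLuo1997
[aside] the cell-posited @[conjecture] predicate `Theorems.CornerTwistWitness.CornerTwistWitnessAt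
W` (p556532 `Theorems/ClassRecordThreeCornerTwistWitnessDefs.lean`: the ∃-recut of (Tw) — ONE odd
Heegner twin per corner pair with BSD₃ of the rank-0 twist) for every minimal W — the second
conjunct of crux CornerAtThreeW stated alone — filed as a by-name ASIDE (banked context: never
staffed, not progress, BC6-exempt) so the @[conjecture] leaf is item-stated under the #15c rule
(head of the conclusion under ∀/→); precedent 19408–19410 (the three leaves of 19111); no closes /
tribunal / tribunal_fit change -/
@[route_item "route-BirchSwinnertonDyer-KolyvaginRoadThree"]
def CornerTwistWitnessLeafAtThree : Prop :=
  ∀ (W : WeierstrassCurve ℚ) [W.IsElliptic] [W.IsGloballyMinimal], Summit.BirchSwinnertonDyer.BirchSwinnertonDyer.Theorems.CornerTwistWitness.CornerTwistWitnessAt W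

/-- item stmt-BirchSwinnertonDyer-23091 · aside · rank 9 · open · by planner
sources: GrossLMS1991, Prop. 3.7 (2) p. 240
[aside, cite-only] Gross 1991 Prop. 3.7 (2) (Nekovář 2007 Prop. 4.9/4.13(ii)): the Frobenius
congruence y_n ≡ Frob_ℓ y_m (mod λ_n) of the Heegner Euler system, image-free named fact (PUBLISHED;
no mod-p image or CM hypothesis). Print head (γ) of p4's stub_jetchevX9 chain. [cite: GrossLMS1991,
Prop. 3.7 (2) p. 240] [cite: Nekovar2007, Prop. 4.9, 4.13 (ii)] — conjunct 1 of JetchevPrintFactsX9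
— filed so the cite_only head constant is item-stated BY NAME (gate5 #15c one rule; staffable
remedy); banked context (D-0019 aside): never staffed, not progress, closes only when the named fact
becomes a theorem. -/
@[route_item "route-BirchSwinnertonDyer-KolyvaginRoadThree"]
def GrossFrobeniusCongruenceImageFreeFact : Prop :=
  Literature.NumberTheory.EllipticCurves.GrossLMS1991.prop37_2_frobeniusCongruence

/-- item stmt-BirchSwinnertonDyer-23093 · aside · rank 9 · open · by planner
sources: GrossLMS1991, §6 p. 245, GrossZagier1986Heegner, III (3.1) p. 256
[aside, cite-only] GZ86 III (3.1) / Gross 1991 p. 245: for every finite place w ∣ N of K[n], the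
Heegner point y_n lies in E⁰(K[n])_w up to a rational torsion point — image-free named fact
(PUBLISHED; primary GZ86 unheld acq-00078, deduction printed in Gross 1991 §6). [cite: GrossLMS1991,
§6 proof of Prop. 6.2 (1), p. 245] [cite: GrossZagier1986Heegner, III (3.1)] — conjunct 3 of
JetchevPrintFactsX9 — filed so the cite_only head constant is item-stated BY NAME (gate5 #15c one
rule; staffable remedy); banked context (D-0019 aside): never staffed, not progress, closes only
when the named fact becomes a theorem. -/
@[route_item "route-BirchSwinnertonDyer-KolyvaginRoadThree"]
def GrossHeegnerPointRatTorsionImageFreeFact : Prop :=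
  Literature.NumberTheory.EllipticCurves.Gross1991_heegnerPoint_sub_ratTorsion_mem_E0_imageFree

/-- item stmt-BirchSwinnertonDyer-23176 · aside · rank 9 · closed · proved by Summit.BirchSwinnertonDyer.BirchSwinnertonDyer.Theorems.EulerHalvesPT2.classRecordThree_poitouTateShaTateDualFact (planner) · by planner
[aside] Poitou-Tate duality of Sha^1(K, M^D) and Sha^2(K, M) for a finite Galois module over a
number field (Harari 2020 Thm 17.13 (b); Milne ADT I Thm 4.10 (a); Tate 1962 Thm 3.1) — cite-tagged
Literature named fact, binder hPT2 of the r21 items-closer p657849 of crux 19109; item-stated BY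
NAME (RULING 72/73 idiom) so the closer's print inputs are route items; banked context, never
staffed, cap-neutral -/
@[route_item "route-BirchSwinnertonDyer-KolyvaginRoadThree", crux]
def PoitouTateShaTateDualFact : Prop :=
  ∀ (K : Type) [Field K] [NumberField K], Literature.NumberTheory.GaloisCohomology.poitouTate_sha_tateDual K

-- `PoitouTateShaTateDualFact` holds: proved by `Summit.BirchSwinnertonDyer.BirchSwinnertonDyer.Theorems.EulerHalvesPT2.classRecordThree_poitouTateShaTateDualFact` (its module imports this route file, so no `_holds` link can be stated here).

/-- item stmt-BirchSwinnertonDyer-23177 · aside · rank 9 · open · by planner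
[aside] the CM-point / Heegner-system primitives over ring class fields at p = 3 INERT (Cai-Shu-Tian
2014 Thm 1.5 special case 1; Nekovar 2007 Thm 3.2, (4.8), (4.9); Gross 1991 Props 3.7, 5.3, (4.1);
Bertolini-Darmon 1996 Prop 2.6; Darmon 2004 Prop 3.11; JSW 2017 Rem 17-18; Pasten 2024 Prop 5.1) —
cite-tagged Literature named fact (p568288), binder hPrim of p657849; item-stated BY NAME; banked
context, never staffed, cap-neutral -/
@[route_item "route-BirchSwinnertonDyer-KolyvaginRoadThree", crux]
def ShimuraPrimitivesAtThreeInertFact : Prop :=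
  Literature.NumberTheory.EllipticCurves.shimuraCurve_heegnerSystem_primitivesAtThreeInert

/-- item stmt-BirchSwinnertonDyer-23178 · support · rank 9 · open · by planner
why it might fail: the X11a lower bound at p = 3 needs an IMC input at 3 outside the printed hypotheses (Skinner 2016 Thm C assumes p >= 5 in places)
sources: Skinner2016PacificMC, SkinnerUrban2014
[support] the X11a LOWER HALF AT p = 3 (ER5 item 19064 X11aLowerHalf read at 3) = the REGISTERED
stub `stub_x11aLowerHalfAtThree` of 19109's line inert r20 VERBATIM (stub ≡ item; RULING 73 (d)):
for every globally minimal V of class X11a at 3, the missing lower bound ord_3 #Sha_an <= ord_3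
#Sha. LEAD er5-p1 g4 showed (p657101) that 19715 at 5 consumes only the p >= 5 restriction of 19064,
so the two halves of 19064 now live where they are consumed. Supported by the x11a seats'
Mazur-core-at-3 work (p646859). why it might fail: = 19064's at 3 (Skinner 2016 Thm C / SU14 3.29
hypotheses at p = 3). sources: Skinner2016PacificMC Thm C; SkinnerUrban2014 Thm 3.29 -/
@[route_item "route-BirchSwinnertonDyer-KolyvaginRoadThree", crux]
def X11aLowerHalfAtThree : Prop :=
  ∀ (V : WeierstrassCurve ℚ) [V.IsElliptic] [V.IsGloballyMinimal], Summit.BirchSwinnertonDyer.Rank1Residual.ClassX11a V 3 → Literature.NumberTheory.EllipticCurves.Rank1Residual.Typed.MissingLowerBoundAt V 3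

/-- item stmt-BirchSwinnertonDyer-23691 · aside · rank 9 · open · by planner
[aside, cite_only] Friedberg–Hoffstein 1995 Thm B in the SQUARE-level form (a quadratic twist with
L(E^d,1) ≠ 0, d inert at the prescribed Cartan place q with q² ∥ N and split at the other bad
primes): input (F4) of line `cartan` on crux 23422 EulerHalvesAtThreeResidualUpperBound, item-stated
BY NAME so the line's _of binds it as a route item instead of a registered stub restating print
(RULINGS 72 / 82 (b)); banked context, never staffed, cap-neutral. -/
@[route_item "route-BirchSwinnertonDyer-KolyvaginRoadThree", crux]
def FriedbergHoffsteinTwistInertAtSq : Prop :=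
  Literature.NumberTheory.EllipticCurves.friedbergHoffstein_exists_twist_ne_zero_inertAt_sq

/-- item stmt-BirchSwinnertonDyer-23754 · aside · rank 9 · open · by planner
[aside, cite_only] (F3) of line `cartan` on crux 23422: a Shimura/Cartan-level modular
parametrisation of the corner curve exists (Jacquet–Langlands + Cai–Shu–Tian Prop. 3.8;
Literature/NumberTheory/Automorphic/ShimuraCurveCartanLevel.lean, p671426, bsd-idea-10 §C0 records
typed by tam3-p1 g20); item-stated BY NAME so the line binds it as a route item (RULINGS 72/82
(b)/83); banked context, never staffed, cap-neutral. -/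
@[route_item "route-BirchSwinnertonDyer-KolyvaginRoadThree", crux]
def CartanParametrizationDataNonemptyFact : Prop :=
  Literature.NumberTheory.Automorphic.nonempty_cartanParametrizationData

/-- item stmt-BirchSwinnertonDyer-23828 · aside · rank 9 · open · by planner
[aside, cite_only] (F1) of line `cartan` on crux 23422: Heegner-system primitives at 3 on the
Cartan-level curve (Kolyvagin–Logachëv / KP Prop. 3.4, Def. 3.5 + Cai–Shu–Tian Thm. 1.5 special case
1; same Literature module p671426); item-stated BY NAME (RULINGS 72/82 (b)/83); banked context,
never staffed, cap-neutral. -/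
@[route_item "route-BirchSwinnertonDyer-KolyvaginRoadThree", crux]
def CartanHeegnerPrimitivesAtThreeFact : Prop :=
  Literature.NumberTheory.Automorphic.cartanCurve_heegnerSystem_primitivesAtThree

/-- item stmt-BirchSwinnertonDyer-27981 · aside · rank 9 · open · by planner
sources: GrossLMS1991, Prop. 3.7 (2) p. 240 and §6 p. 245, GrossZagier1986Heegner, III (3.1) p. 256
[support] RULING 65 (c)(i) (planner bsd-stepL g41, 2026-08-28): the TWO PRINTED Heegner-Euler-system
facts the carrier lines consume BY NAME, in IMAGE-FREE form — Gross 1991 Prop. 3.7 (2) «Frobenius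
congruence for the derived classes» stated without the surjectivity / no-CM hypotheses
(`GrossLMS1991.prop37_2_frobeniusCongruence`, module HeegnerEulerSystemCongruenceImageFree) ∧ Gross
1991 §6 / Gross–Zagier 1986 III (3.1) «the Heegner point minus its complex conjugate lies in E⁰ at
the bad places, up to rational torsion», image-free
(`Gross1991_heegnerPoint_sub_ratTorsion_mem_E0_imageFree`; implies the image-restricted form via
`…_of_imageFree`). Cite-only Literature named facts (XL as typed, sorry-free defs); consumers: 19715
EulerHalfNotRamNoInertSetAtFive (closer over p632931), 19065 NonSurjCorner r16 slot 5 conjunct 1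
(TEXT-IDENTICAL), 21420 / 19109 at 3 by signature dedup. Same idiom as items 19716 / 20191 / 20442.
[deps: none] [difficulty: cite-only] -/
@[route_item "route-BirchSwinnertonDyer-KolyvaginRoadThree", crux]
def EulerHalfGrossPrintFacts : Prop :=
  Literature.NumberTheory.EllipticCurves.GrossLMS1991.prop37_2_frobeniusCongruence ∧ Literature.NumberTheory.EllipticCurves.Gross1991_heegnerPoint_sub_ratTorsion_mem_E0_imageFree

/-- item stmt-BirchSwinnertonDyer-19157 · assembly · rank 1 · closed · proved by Summit.BirchSwinnertonDyer.BirchSwinnertonDyer.Theorems.kolyvaginRoadThree_assembly_holds (prover) · by planner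
sources: McCallumLMS1991, WZhang2014, Castella2018
[assembly] ZhangSharpFrameAtThree → SchneiderTamAtThree → HalvesTamAtThree → HsiehDescentAtThree →
EulerHalvesAtThree → ShimuraDisplaysAtThree → CornerAtThree → PublishedInputsKolyThree → the rung-K2
leaf `X11b.MultiplicativeRankOneAtThree`. -/
@[route_item "route-BirchSwinnertonDyer-KolyvaginRoadThree"]
def Assembly : Prop :=
  ZhangSharpFrameAtThree → SchneiderTamAtThree → HalvesTamAtThree → HsiehDescentAtThree → EulerHalvesAtThree → ShimuraDisplaysAtThree → CornerAtThree → PublishedInputsKolyThree → Summit.BirchSwinnertonDyer.Rank1Residual.X11b.MultiplicativeRankOneAtThree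

-- `Assembly` holds: proved by `Summit.BirchSwinnertonDyer.BirchSwinnertonDyer.Theorems.kolyvaginRoadThree_assembly_holds` (its module imports this route file, so no `_holds` link can be stated here).

/-! D-0027 §2.1 — DECIDING THEOREM (planner-authored via `route open/edit --closes-file`; by planner-bsd-stepL-plan-g37-0 2026-08-27T20:01:28Z):
its hypotheses are this route's items and its conclusion the registered leaf `Summit.BirchSwinnertonDyer.Rank1Residual.X11b.MultiplicativeRankOneAtThree` (rung K2, D-0061) (glue_lint), and it elaborates with this file. -/

@[closes "route-BirchSwinnertonDyer-KolyvaginRoadThree"] theorem closes (h₁ : ZhangSharpFrameAtThreeHL) (h₂ : SchneiderTamAtThree) (hLZZ : LZZWaldspurgerHeegner) (h3R : IMCDivTwoLociTamAtThreeR)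
    (hTS : TateSenVanishingAtThree) (hW : BDPWaldspurgerSquare) (h₅ : EulerHalvesAtThree) (h₆ : CornerAtThreeW)
    (h₇ : PublishedInputsKolyThree)
    (hJL : ShimuraParametrizationDataNonempty) (hRT : PastenRibetTakahashiPackage)
    (hOff : ShimuraCurveFactOffLocusThree)
    (hCT3 : ShimuraCasselsTateLevelInputs) (hESs : ShimuraHeegnerEulerSystemSplitPrinted) :
    Summit.BirchSwinnertonDyer.Rank1Residual.X11b.MultiplicativeRankOneAtThree := by
  have h₄ : HsiehDescentAtThree := Summit.BirchSwinnertonDyer.BirchSwinnertonDyer.Theorems.WaldspurgerKernel.hsiehDescentAt₃_of_thm54_of_tateSen hW hTS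
  have hV := Summit.BirchSwinnertonDyer.BirchSwinnertonDyer.Theorems.LZZKernel.bdpValueAt₃_of_thm151_thm153 hLZZ
  have h₃ : HalvesTamAtThreeR := fun W _ _ hX ↦
    ⟨fun hram hsp htam ↦ ⟨hV W, (h3R W hX).1 hram hsp htam⟩, fun hnr hsurj ↦ ⟨hV W, (h3R W hX).2 hnr hsurj⟩⟩
  obtain ⟨⟨hGZ, hKo, hB, hSk, hWu, hGZK, hmod, hnf, hHL, hMaz, hPT, hFH, hBR, hSkA, hJn, hHn, hD, hpar, hMN, hH⟩,
    hMc, hrec, hKD⟩ := h₇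
  have hSGZ : ShimuraHeegnerPointGrossZagierPrinted :=
    Summit.BirchSwinnertonDyer.BirchSwinnertonDyer.Theorems.ShimuraHeegnerPrimitivesSplitNamed.shimuraHeegnerPointGrossZagierPrinted_body_of_primitivesSplitReduced hESs
  have hKO : ShimuraKolyvaginOrderBoundAtThreeSurj :=
    Summit.BirchSwinnertonDyer.BirchSwinnertonDyer.Theorems.ShimuraHeegnerPrimitivesSplitNamed.shimuraKolyvaginOrderBoundAtThreeSurj_body_of_poitouTate_of_GZK_of_modularity_of_casselsTateLevelInputs_of_primitivesSplitReduced
      hPT hGZK hmod hCT3 hESs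
  exact Summit.BirchSwinnertonDyer.BirchSwinnertonDyer.Theorems.multiplicativeRankOneAtThree_of_kolyRecord_upperB_of_twistWitness
    hGZ hKo hB hSk hWu hGZK hmod hnf hHL hMaz hPT hSkA hJn hHn hD hpar hMN hH
    (fun W _ _ hX hram htam ↦
      Summit.BirchSwinnertonDyer.Rank1Residual.X11b.Three.Koly.bsdp_three_onA1_of_kolyvaginFramesHL hGZ hKo hB hSk
        hGZK hmod hnf hHL hMaz hrec hMc hKD h₁ W hX hram htam)
    h₂ (fun W _ _ hX ↦ (h₄ W hX).1) (fun W _ _ hX ↦ (h₃ W hX).1)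
    (fun W _ _ hX hram _ hα hγ _ ↦
      Summit.BirchSwinnertonDyer.BirchSwinnertonDyer.Theorems.ShimuraKolyvaginSurjSuffices.classRecordThree_shimuraUpperHalfAtThree_of_published_surj
        hSk hGZK hmod hnf hFH hMaz hBR hJL hRT
        (fun W _ _ p _ N _ K _ _ S Dt X W' _ P₀ hN hsurj hp2 hirr hK hS hin hsp hps hmin ↦ by
          by_cases hloc : p = 3 ∧ p ∣ N
          · obtain ⟨P, degS, h0, hv, hL⟩ := hSGZ W p N K S Dt X W' P₀ hN hp2 hirr hK hS hin hsp hps hmin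
            obtain ⟨hp3, hpN⟩ := hloc
            subst hp3
            exact ⟨P, degS, h0, hv, hL,
              hKO W 3 N K S Dt X W' P₀ hN hsurj hp2 hirr hK hS hin hsp hps hmin hpN rfl P degS h0 hv hL⟩
          · exact hOff W p N K S Dt X W' P₀ hN hp2 hirr hK hS hin hsp hps hmin hloc)
        W hX hram hα hγ)
    (fun W _ _ hX ↦ (h₅ W hX).1) (fun W _ _ hX ↦ (h₅ W hX).2.1)
    (fun W _ _ hX ↦ (h₄ W hX).2) (fun W _ _ hX ↦ (h₃ W hX).2) (fun W _ _ hX ↦ (h₅ W hX).2.2)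
    (fun W _ _ ↦ (h₆ W).1) (fun W _ _ ↦ (h₆ W).2.1) (fun W _ _ ↦ (h₆ W).2.2)

end Summit.BirchSwinnertonDyer.BirchSwinnertonDyer.Theses.KolyvaginRoadThree
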